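import Literature.MathematicalPhysics.QuantumFieldTheory.Balaban1983to89.B9SectBL2GFrameCodedY
import Literature.MathematicalPhysics.QuantumFieldTheory.Balaban1983to89.B9SectBL2GStepAtLettersV3
import Literature.MathematicalPhysics.QuantumFieldTheory.Balaban1983to89.B9SectBL2SecondOrderY
import Literature.MathematicalPhysics.QuantumFieldTheory.Balaban1983to89.B9SectBKerLettersL2Y
import Literature.MathematicalPhysics.QuantumFieldTheory.Balaban1983to89.B9Ineq349L2ReadingsP
import Literature.MathematicalPhysics.QuantumFieldTheory.Balaban1983to89.B9Ineq368L2FP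

/-!
# `Balaban1983to89.B9SectBL2GRead377Y` — ★★★ (3.77) p. 406 IN BLOCK-`ℓ²` FOR THE CONCRETE `P₁(A)` AT NODE 00's CODED LETTERS:
# `read377L2_gFrame₅CodedOn : Read377L2 (gFrame₅CodedOn …)` — the LAST displayed printed law of the `L²` member of the Sect.-B step of record, G side
# (pub-ymgap N06 row 13; brick F3 of the `Read377L2` port), now a THEOREM

T. Bałaban, *Propagators for lattice gauge theories in a background field*, Commun. Math. Phys. **99** (1985) 389–434
[`Balaban1985BackgroundPropagators`, "B9"], (3.77) p. 406, (3.76) p. 405, (3.49) p. 399, (3.68) p. 403, (3.57)–(3.67) pp. 401–403, Thm 3.2 (3.48) p. 398,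
Thm 3.1 (3.46) p. 398, (3.19)–(3.21) pp. 393–394, (3.24)–(3.25) p. 394, Thm 3.4 p. 400; [4] = T. Bałaban, *Propagators and renormalization transformations for
lattice gauge theories. II*, Commun. Math. Phys. **96** (1984) 223–250 [`Balaban1984PropagatorsII`], Lemma 2.1 p. 234, (2.51)–(2.52) p. 232, (2.69) p. 235,
Prop. 2.6 (2.140)–(2.141) p. 247.

statement-level skeleton of published theorems with citation tags; proofs where landed; nothing here is a claim about the Yang–Mills mass gap

THE PRINTED LOCUS (verbatim).  (3.77) p. 406: *"|P₁(A)| ≦ O(1)α₁e^{−δd(y,y′)}"*, with (3.49) p. 399 (the entries of `R(U) = G′Q′*C⁻¹Q′G′`), (3.68) p. 403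
(`P(U′U) = P(U) + P′(A)`), (3.57) p. 401, (3.64)–(3.67) pp. 402–403 (*«The inverse satisfies Theorem 3.2»*), Theorem 3.2 (3.48) p. 398.

WHY THIS FILE (seat dag-n06-c gen 15).  gen 14's `B9SectBL2GFrameCodedV8Y.stepL2Pos_KACU_frame₈_on` — the (3.46) member of `SectBStepU`'s G side at
NODE 00's coded letters — displays, beyond gen 13's laws of `gFrame₅CodedOn`, ONE printed law: `B9SectBL2GFrameCodedY.Read377L2 (gFrame₅CodedOn …)`,
(3.77) in block-`ℓ²` for the concrete `P₁(A)` at the frame's `R`-words `G′Q′*C⁻¹Q′G′` (C⁻¹ on the block carrier `P = BlkY × ι`).  THIS FILE PROVES IT: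
g6's assembly `B9SectBL2GStepAtLettersV3.read377_of_l2GFrame₃` (scalar `C⁻¹` carrier) re-threaded over the block carrier with gen 14's bricks —
§0 devices: a sup block majorant on `P` is a block-`ℓ²` one with `√|ι|` (`hasL2Majorant_blkP_of_hasMajorant`, fibres of `ι_B ∘ fst`), the (3.42)∕(3.46)
blocks of the coded family `KSC` at a base ARE the record's (`decY (base U) = U`), the weight `w_c = W^{−1/2} = η^{(d+1)/2}(Lʲη)^{−(d+1)/2}` and its p. 398
volume-ratio transfer (`transfer_wcY`, constant `(ℓ+1)^{(d+1)/2}`); §1 NODE 00's structured `ℓ²` readings of `Q′, Q′*` at the base AND at the product and of the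
(3.57) variations in the brick shapes (`l2ReadingsQ_pair`: gen 14's `B9SectBKerLettersL2Y` + g7's (3.59) law `varParY_of_cplxLettersY` + `qcC_prod`);
§2 ★★★ `read377L2_gFrame₅CodedOn`: call rate `δ′ = min(rate(min δ₀/2 δ₁), rateR(rate δ₀/2))`; the G′-side input at `U` converted to gen 9's augmented
readings `KSC₃` (`B9SectBL2SecondOrderY.l2Block_KSC₃_base_of_record` under the plaquette law supplied by the displayed `hreg335P`, [4] Lemma 2.1 from
`d261Y_spec`, the p. 398 transfers) and read in the frame shapes (`readL2_KSC₃`, `readL2_two_KSC₃`); the block-`ℓ²` entries of `G′(U′U)` from the `L²` frame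
INHABITED at `KSC₃` (gen 9's `l2Frame₂CodedOn`; `l2entries_ext_of_l2Frame₂`, `l2rightEntries_ext_of_l2Frame₂`); r06's `thm34_Gp_uniform` (inverse identities,
`gop_eq`) and BLOCK-CARRIER `thm34_Cinv_uniform_blk` (C⁻¹(U′U) = `Tinv` by `cop_eq`, with its (3.48) block majorant on `P`); the block-`ℓ²` (3.63) both sides;
(3.65); then gen 14's `B9Ineq368L2FP.ineq368_l2_FP`, `B9Ineq349L2ReadingsP.ineq349_l2Hom_of_readingsP` and g5's `B9Ineq377L2Hom.ineq377_l2_concreteE`.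
With it n06-d's knit takes `stepL2Pos_KACU_frame₈_on … (read377L2_gFrame₅CodedOn …) d261 h261`: the `L²` member displays NO printed `ℓ²` law beyond gen 13's.

HONEST SCOPE.  An assembly of landed frames ∕ bricks over NODE 00's DEFINED letters; the displayed laws of `gFrame₅CodedOn` (gen 13's binders `hunitX hsym hunitA
hparB hb₁ hreg335P hC37G hvarB hMd hnbr`) remain hypotheses; nothing of [B9] asserted beyond the tree's theorems; N06 NOT discharged; count-neutral; nothing
continuum ∕ OS ∕ mass-gap ∕ Clay.  No `sorry`, no `axiom`, no `instance`, no `notation`, no new `… : Prop`.  Cell `pub-ymgap` (HUMAN RULING D-0062), Track A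
node N06 [B9], N06-ASSIGNMENT row 13, 2026-08-29; `--supports stmt-QuantumFields-27364`.

RELATED IN THE TREE, NOT DUPLICATED (used by name): `B9SectBL2GStepAtLettersV3` (`read377_of_l2GFrame₃` = the scalar-carrier template, `kappa377_le_one`),
`B9SectBL2GFrameCodedY` (`Read377L2`, `d261Y_spec`), `B9SectBGFrameCodedY` (`gFrame₅CodedOn`), `B9SectBKerFrameCodedY` (`cinvFrame₃CodedOn`: `readKer`,
`cop_eq`, `hQc`), `B9SectBL2DictionaryY` (`l2Frame₂CodedOn`, `readL2_KSC₃`, `readL2_two_KSC₃`, `eBlock_KSC₃_iff`), `B9SectBL2SecondOrderY`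
(`l2Block_KSC₃_base_of_record`), `B9SectBCodedChainL2` (`l2Block_weaken`), `B9SectBKerLettersL2Y` (`wcY`, `wsY`, `hasL2MajorantHom_QcC ∕ QcsC ∕ FcC ∕ FcsC`),
`B9Ineq349L2ReadingsP`, `B9Ineq368L2FP`, `B9Ineq377L2Hom`, `B9Ineq363L2(Right)`, `B9Thm34SectBUniformR1.thm34_Gp_uniform`, `B9Thm34InvBlk.thm34_Cinv_uniform_blk`,
`B9RWSums347DefiniteFacesWindow` (`scaleTransfer_rpow_geo9Y`, `scaleTransfer6_window_geo9Y`), `B9SectBL2GCrossY.plaqLawY_of_reg335PlaqY`.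
-/

noncomputable section

open scoped BigOperators

namespace Literature.MathematicalPhysics.QuantumFieldTheory.Balaban1983to89.B9SectBL2GRead377Y

open B6Ineq2142KLevelV1 (β)
open B6KLevelCensusIndexV1 (KIdx kGeo)
open B6RandomWalk (HasMajorant BlockSupp hasMajorant_mono Ineq261 blockPiece)
open B6RandomWalkL2 (HasL2Majorant hasL2Majorant_mono l2n l2n_nonneg l2n_sq abs_apply_le_l2n)
open B6RandomWalkL2Hom (HasL2MajorantHom hasL2MajorantHom_mono hasL2MajorantHom_add)
open B6Ineq268MultiLevelBox (W W_eq W_pos)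
open B9Thm34Ext (toB6)
open B9Ineq347 (ScaleTransfer)
open B9FromB6 (EBlock L2Block pref4_nonneg pref6_nonneg)
open B9PinMembersKLevelV1 (MemberY geo9Y bg9Y)
open B9Eq360DeltaPrimeAY (AfldY)
open B9Eq352DivFormLetters (conj)
open B9Eq352GradLetters (diffLetter)
open B9Eq360VprimeLetters (vPrimeConc)
open B9SectBGpLettersY (decY decY_base GVal blkC coordC GopC norm_le_one_and_inv_of_mem)
open B9SectBGpFrameCodedY (codingYx CplxLettersY)
open B9SectBGpReadingsY (KSC etaS_eq_eta len_label)
open B9SectBCodedCarrier (CCfg pullS)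
open B9SectBCodedReadingsU (KACU)
open B9SectBKerFrameCodedY (CinvY VarParY varParY_of_cplxLettersY len_ιB)
open B9SectBKerLettersY (QcC QcsC CopC FcC FcsC qcC_prod qcsC_prod)
open B9SectBKerLettersL2Y (wcY wsY wcY_nonneg wsY_nonneg wsY_mul_wcY hasL2MajorantHom_QcC hasL2MajorantHom_QcsC hasL2MajorantHom_FcC hasL2MajorantHom_FcsC)
open B9SectBGFrameCodedY (gFrame₅CodedOn)
open B9SectBL2GFrameCodedY (Read377L2 d261Y M261Y d261Y_spec)
open B9SectBL2DictionaryY (KSC₃ l2Frame₂CodedOn readL2_KSC₃ readL2_two_KSC₃ eBlock_KSC₃_iff)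
open B9SectBL2SecondOrderY (l2Block_KSC₃_base_of_record cross2ConstL2 cross2ConstL2_nonneg)
open B9SectBL2TransferInY (crossConstL2 crossConstL2_nonneg)
open B9SectBCodedChainL2 (l2Block_weaken)
open B9SectBL2GCrossY (plaqLawY_of_reg335PlaqY)
open B9SectBGClassLettersY (Reg335PlaqY CplxLettersGY VarParBY)
open B9SectBL2StepAtLettersV2 (cVL2_le_one l2entries_ext_of_l2Frame₂)
open B9SectBL2StepAtLettersV2Right (rateR rateR_pos l2rightEntries_ext_of_l2Frame₂)
open B9SectBL2GStepAtLettersV3 (kappa377_le_one)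
open B9Thm34SectBUniformR1 (thm34_Gp_uniform)
open B9Thm34InvBlk (thm34_Cinv_uniform_blk)
open B9Ineq363L2 (cVL2 cVL2_nonneg ineq363_l2_vPrime eq365_of_inverse hasL2Majorant_rate_mono)
open B9Ineq363L2Right (hasL2Majorant_gp_vPrime eq365_first_of_inverse)
open B9Ineq377POne (kappa377 kappa377_nonneg)
open B9Ineq368PPrime (kappa349)
open B9Ineq368L2F (kappa368F)
open B9Thm34GL2Entries (pOneConc)
open B9Ineq349L2ReadingsP (ineq349_l2Hom_of_readingsP)
open B9Ineq368L2FP (ineq368_l2_FP)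
open B9Ineq377L2Hom (ineq377_l2_concreteE)
open B9RWSumsReadsNbr (nbr)
open B9RWSums347DefiniteFacesWindow (scaleTransfer6_window_geo9Y)
open B9GeoLemma21KLevelV1 (geo9K_one_le_L geo9Y_len_pos geo9K_eta_pos)
open B9GeoNormsKLevelV1 (geo9K geo9K_dist_nonneg)
open Node00 (SiteY BlkY IBondY CfgY SiteParY BondParY GAY GpY XY deltaAY deltaPrimeAY kernelFamilyS etaS)

variable {d ℓ : ℕ} {hd : 1 ≤ d + 1} {hL : Odd (ℓ + 1) ∧ 1 < ℓ + 1} {b₀ b₁ : ℝ} {Mstar : ℕ}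
variable {𝔸 : Type} [NormedRing 𝔸] [NormedAlgebra ℂ 𝔸] [CompleteSpace 𝔸]

/-! ## §0 Devices -/

section Devices

variable {g : B6.Geometry} {X : Type} [Fintype X]

/-- pointwise bound on a finite support ⟹ `ℓ²` bound with the square root of the cardinality. [cite: Balaban1984PropagatorsII, Prop. 2.6 (2.140) p.247 (bookkeeping, ours)] -/
theorem l2n_le_sqrt_card_mul (v : X → ℝ) (s : Finset X) (hoff : ∀ x, x ∉ s → v x = 0) {C : ℝ} (hC : 0 ≤ C)
    (hb : ∀ x ∈ s, |v x| ≤ C) : l2n v ≤ Real.sqrt s.card * C := by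
  have h2 : l2n v ^ 2 ≤ (Real.sqrt s.card * C) ^ 2 := by
    rw [l2n_sq, mul_pow, Real.sq_sqrt (Nat.cast_nonneg _)]
    calc ∑ x, v x ^ 2 = ∑ x ∈ s, v x ^ 2 := by
          rw [← Finset.sum_subset (Finset.subset_univ s) fun x _ hx => by rw [hoff x hx]; ring]
      _ ≤ ∑ _x ∈ s, C ^ 2 := Finset.sum_le_sum fun x hx => by
          have := hb x hx
          rw [← sq_abs]; exact pow_le_pow_left₀ (abs_nonneg _) this 2
      _ = s.card * C ^ 2 := by rw [Finset.sum_const, nsmul_eq_mul]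
  have h0 : 0 ≤ Real.sqrt s.card * C := mul_nonneg (Real.sqrt_nonneg _) hC
  nlinarith [l2n_nonneg v, h2, h0]

/-- ★ **SUP BLOCK MAJORANT ⟹ BLOCK-`ℓ²` MAJORANT WITH THE FIBRE MULTIPLICITY** (`‖Δ(y)Tu‖₂ ≦ √N·K(y,y′)·‖u‖₂` when the fibres of the block map have
at most `N` points: `sup ≦ ℓ²` on the input block, `ℓ² ≦ √N·sup` on the output block). [cite: Balaban1984PropagatorsII, (2.51) p.232, Prop. 2.6 (2.140) p.247; derivation ours] -/
theorem hasL2Majorant_of_hasMajorant_fibre (blk : X → g.Site) (N : ℕ)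
    (hN : ∀ (y : g.Site) (s : Finset X), (∀ x ∈ s, blk x = y) → ((s.card : ℕ) : ℝ) ≤ N)
    {T : Module.End ℝ (X → ℝ)} {K : g.Site → g.Site → ℝ} (hK : ∀ y y', 0 ≤ K y y') (hT : HasMajorant blk T K) :
    HasL2Majorant blk T (fun y y' => Real.sqrt N * K y y') := by
  classical
  intro y y' u hu
  have hBS : BlockSupp blk u y' (l2n u) := ⟨l2n_nonneg u, fun x _ => abs_apply_le_l2n u x, hu⟩
  have hpt : ∀ x, |T u x| ≤ K (blk x) y' * l2n u := fun x => hT y' u (l2n u) hBS x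
  set s : Finset X := Finset.univ.filter fun x : X => blk x = y with hs
  have hsN : ((s.card : ℕ) : ℝ) ≤ N := hN y s fun x hx => (Finset.mem_filter.1 hx).2
  have h := l2n_le_sqrt_card_mul (blockPiece blk y (T u)) s
    (fun x hx => by
      have hx' : blk x ≠ y := fun h => hx (Finset.mem_filter.2 ⟨Finset.mem_univ _, h⟩)
      simp [blockPiece, hx'])
    (mul_nonneg (hK y y') (l2n_nonneg u)) (fun x hx => by
      have hx' : blk x = y := (Finset.mem_filter.1 hx).2
      simp only [blockPiece, hx', if_true]
      rw [← hx']; exact hpt x)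
  refine h.trans ?_
  have h1 : Real.sqrt (s.card : ℝ) ≤ Real.sqrt N := Real.sqrt_le_sqrt hsN
  have h2 : 0 ≤ K y y' * l2n u := mul_nonneg (hK y y') (l2n_nonneg u)
  calc Real.sqrt (s.card : ℝ) * (K y y' * l2n u) ≤ Real.sqrt N * (K y y' * l2n u) := mul_le_mul_of_nonneg_right h1 h2
    _ = Real.sqrt N * K y y' * l2n u := by ring

/-- two `if`s on one condition through different `Decidable` instances, compared branchwise (scaled). [cite: Balaban1984PropagatorsII, (2.52) p.232 (bookkeeping, ours)] -/
theorem mul_ite_le_ite {P : Prop} (d₁ d₂ : Decidable P) {c a a' : ℝ} (h : c * a ≤ a') :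
    c * (@ite ℝ P d₁ a 0) ≤ @ite ℝ P d₂ a' 0 := by
  by_cases hP : P
  · simp only [if_pos hP]; exact h
  · simp only [if_neg hP, mul_zero, le_refl]

/-- the same with an added `if`. [cite: Balaban1984PropagatorsII, (2.52) p.232 (bookkeeping, ours)] -/
theorem mul_ite_add_ite_le_ite {P : Prop} (d₁ d₂ d₃ : Decidable P) {c a a' a'' : ℝ} (h : c * a + a' ≤ a'') :
    c * (@ite ℝ P d₁ a 0) + @ite ℝ P d₂ a' 0 ≤ @ite ℝ P d₃ a'' 0 := by
  by_cases hP : P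
  · simp only [if_pos hP]; exact h
  · simp only [if_neg hP, mul_zero, add_zero, le_refl]

end Devices


/-! ## §0b The block carrier `BlkY × ι`: sup ⟹ `ℓ²`, blocks -/

section Carrier

variable (x : MemberY d ℓ hd hL b₀ b₁ Mstar) {ι : Type} [Fintype ι] (ιB : BlkY x.toKIdx → IBondY x.toKIdx) {Rr : ℝ} {Hp : Prop}
  [Fintype (geo9Y x).Site]

omit [NormedRing 𝔸] [NormedAlgebra ℂ 𝔸] [CompleteSpace 𝔸] in
/-- ★ on the block carrier `P = BlkY × ι` (block map `ι_B ∘ fst`, `ι_B` a section of `β`): a sup block majorant `B·(Lʲη)^{−4}e^{−δd}` of `T` is the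
block-`ℓ²` majorant `√|ι|·B·(Lʲη)⁻⁴e^{−δd}` (the fibres of `ι_B ∘ fst` have `|ι|` points). [cite: Balaban1985BackgroundPropagators, Thm 3.2 (3.48) p.398, (3.8) p.392; Balaban1984PropagatorsII, (2.51) p.232, Prop. 2.6 (2.140) p.247] -/
theorem hasL2Majorant_blkP_of_hasMajorant (hι : ∀ s : BlkY x.toKIdx, β x.toKIdx.hN x.toKIdx.D x.toKIdx.hk (ιB s) = s)
    {T : Module.End ℝ (BlkY x.toKIdx × ι → ℝ)} {B δ : ℝ} (hB : 0 ≤ B)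
    (hT : HasMajorant (g := toB6 (geo9Y x) Rr Hp) (fun q : BlkY x.toKIdx × ι => ιB q.1) T
      (fun a a' => B * (geo9Y x).len a ^ (-(4 : ℝ)) * Real.exp (-(δ * (geo9Y x).dist a a')))) :
    HasL2Majorant (g := toB6 (geo9Y x) Rr Hp) (fun q : BlkY x.toKIdx × ι => ιB q.1) T
      (fun a a' => Real.sqrt (Fintype.card ι) * B * ((geo9Y x).len a ^ 4)⁻¹ * Real.exp (-(δ * (geo9Y x).dist a a'))) := by
  have hinj : Function.Injective ιB := fun s t h => by rw [← hι s, ← hι t, h]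
  have hN : ∀ (y : (geo9Y x).Site) (s : Finset (BlkY x.toKIdx × ι)), (∀ q ∈ s, ιB q.1 = y) → ((s.card : ℕ) : ℝ) ≤ Fintype.card ι := by
    intro y s hs
    rw [← Finset.card_univ (α := ι)]
    exact_mod_cast Finset.card_le_card_of_injOn (fun q : BlkY x.toKIdx × ι => q.2) (fun _ _ => Finset.mem_coe.2 (Finset.mem_univ _))
      fun q hq q' hq' h => Prod.ext (hinj ((hs q (Finset.mem_coe.1 hq)).trans (hs q' (Finset.mem_coe.1 hq')).symm)) h
  have h := hasL2Majorant_of_hasMajorant_fibre (g := toB6 (geo9Y x) Rr Hp) (fun q : BlkY x.toKIdx × ι => ιB q.1) (Fintype.card ι) hN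
    (fun a a' => by have := geo9Y_len_pos x a; positivity) hT
  refine hasL2Majorant_mono (g := toB6 (geo9Y x) Rr Hp) _ h fun a a' => le_of_eq ?_
  have e4 : (geo9Y x).len a ^ (-(4 : ℝ)) = ((geo9Y x).len a ^ 4)⁻¹ := by
    rw [Real.rpow_neg (geo9Y_len_pos x a).le, ← Real.rpow_natCast]; norm_num
  show Real.sqrt (Fintype.card ι) * (B * (geo9Y x).len a ^ (-(4 : ℝ)) * Real.exp (-(δ * (geo9Y x).dist a a'))) = _
  rw [e4]; ring

omit [Fintype ι] [Fintype (geo9Y x).Site] in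
/-- a (3.42) block with its constant raised and its rate lowered. [cite: Balaban1985BackgroundPropagators, (3.42) p.397, bookkeeping] -/
theorem eBlock_weaken {Bg : B9.Backgrounds} (K : B9.KernelFamily (geo9Y x) Bg) {B B' δ δ' : ℝ} {c : Bg.Cfg}
    (hB : 0 ≤ B) (hle : B ≤ B') (hδ : δ' ≤ δ) (h : EBlock K B δ c) : EBlock K B' δ' c := by
  intro n lam y y' hs
  refine (h n lam y y' hs).trans ?_
  have h1 : 0 ≤ B9.pref4 ((geo9Y x).len y) n := pref4_nonneg (geo9Y_len_pos x y).le n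
  have h3 : 0 ≤ (geo9Y x).supNorm lam := B9GeoNormsKLevelV1.geo9K_supNorm_nonneg x.toKIdx lam
  have h4 : Real.exp (-(δ * (geo9Y x).dist y y')) ≤ Real.exp (-(δ' * (geo9Y x).dist y y')) :=
    Real.exp_le_exp.2 (by have hD : 0 ≤ (geo9Y x).dist y y' := geo9K_dist_nonneg x.toKIdx y y'; nlinarith [mul_le_mul_of_nonneg_right hδ hD])
  have h5 := (Real.exp_pos (-(δ * (geo9Y x).dist y y'))).le
  have h6 : 0 ≤ B' * B9.pref4 ((geo9Y x).len y) n := mul_nonneg (hB.trans hle) h1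
  gcongr

omit [Fintype ι] [Fintype (geo9Y x).Site] in
/-- the (3.46) block of the coded family `KSC` AT A BASE is the record family's at the decoded base (`decY (base U) = U`, by `rfl`). [cite: Balaban1985BackgroundPropagators, Thm 3.1 (3.46) p.398, bookkeeping] -/
theorem l2Block_record_of_KSC_base (G : Subgroup 𝔸ˣ) (par : SiteParY 𝔸 x.toKIdx)
    (C37 C38 : ℝ → CfgY 𝔸 x.toKIdx → AfldY 𝔸 x.toKIdx → Prop) {B₀ δ₀ : ℝ} {U : CfgY 𝔸 x.toKIdx}
    (h : L2Block (KSC G x par C37 C38) B₀ δ₀ (.base U)) :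
    L2Block (kernelFamilyS x.toKIdx (bg9Y 𝔸 G x) (fun U => U) (GpY x.toKIdx par) par) B₀ δ₀ U :=
  fun n lam hh y y' hc hs => h n lam hh y y' hc hs

omit [NormedRing 𝔸] [NormedAlgebra ℂ 𝔸] [CompleteSpace 𝔸] [Fintype ι] [Fintype (geo9Y x).Site] in
/-- ★ **THE WEIGHT `w_c` IN PRINT's UNITS**: `w_c(y) = W(β y)^{−1/2} = η^{(d+1)/2}·(Lʲη)^{−(d+1)/2}` (`W(β y) = (Lʲ)^{d+1}`, `Lʲη` the scale length of `y`). [cite: Balaban1984PropagatorsII, (2.69) p.235; Balaban1985BackgroundPropagators, (3.19) p.393, (3.41) p.397, bookkeeping] -/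
theorem wcY_eq_rpow (hι : ∀ s : BlkY x.toKIdx, β x.toKIdx.hN x.toKIdx.D x.toKIdx.hk (ιB s) = s) (y : IBondY x.toKIdx) :
    wcY x.toKIdx y = etaS x.toKIdx ^ ((((d : ℝ)) + 1) / 2) * (geo9Y x).len y ^ (-((((d : ℝ)) + 1) / 2)) := by
  have hη : 0 < etaS x.toKIdx := by rw [etaS_eq_eta]; exact geo9K_eta_pos x.toKIdx
  have hl : 0 < (geo9Y x).len y := geo9Y_len_pos x y
  set s : BlkY x.toKIdx := β x.toKIdx.hN x.toKIdx.D x.toKIdx.hk y with hs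
  have hW : W x.toKIdx.D.toDomains s = ((((ℓ + 1 : ℕ) : ℝ)) ^ s.1.1) ^ (d + 1) := by rw [W_eq]; push_cast; ring
  have hlen : (geo9Y x).len y = (((ℓ + 1 : ℕ) : ℝ)) ^ s.1.1 * etaS x.toKIdx := by rw [← len_label x ιB hι y]; exact len_ιB x ιB hι s
  have hLj : (((ℓ + 1 : ℕ) : ℝ)) ^ s.1.1 = (geo9Y x).len y / etaS x.toKIdx := by rw [hlen, mul_div_cancel_right₀ _ hη.ne']
  have hq0 : 0 ≤ (geo9Y x).len y / etaS x.toKIdx := div_nonneg hl.le hη.le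
  have hexp : (((d + 1 : ℕ) : ℝ)) * (1 / 2) = (((d : ℝ)) + 1) / 2 := by push_cast; ring
  unfold wcY
  rw [← hs, hW, hLj, Real.sqrt_eq_rpow, ← Real.rpow_natCast _ (d + 1), ← Real.rpow_mul hq0, hexp, ← Real.rpow_neg hq0,
    Real.div_rpow hl.le hη.le, Real.rpow_neg hη.le, div_inv_eq_mul, mul_comm]

omit [NormedRing 𝔸] [NormedAlgebra ℂ 𝔸] [CompleteSpace 𝔸] [Fintype ι] [Fintype (geo9Y x).Site] in
/-- ★ **THE VOLUME-RATIO TRANSFER OF `w_c` ON A RATE WINDOW** (p. 398 remark, exponent `γ = −(d+1)/2`): for every floor rate `κlo > 0`, every member with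
`((d+1)/2)·log(ℓ+1)∕κlo ≦ M` has `e^{−αδd(a,a′)}w_c(a′) ≦ (ℓ+1)^{(d+1)/2}w_c(a)` at every rate pair with `κlo ≦ αδ`. [cite: Balaban1985BackgroundPropagators, p.398 remark after (3.47); Balaban1984PropagatorsII, Lemma 2.1 (2.60) p.234, (2.69) p.235] -/
theorem transfer_wcY (hι : ∀ s : BlkY x.toKIdx, β x.toKIdx.hN x.toKIdx.D x.toKIdx.hk (ιB s) = s) {κlo : ℝ} (hκlo : 0 < κlo) {δ α : ℝ}
    (hκ : κlo ≤ α * δ) (hM : (((d : ℝ)) + 1) / 2 * Real.log ((ℓ : ℝ) + 1) / κlo ≤ (geo9Y x).M) (a a' : IBondY x.toKIdx) :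
    Real.exp (-(α * δ * (geo9Y x).dist a a')) * wcY x.toKIdx a' ≤ ((ℓ : ℝ) + 1) ^ ((((d : ℝ)) + 1) / 2) * wcY x.toKIdx a := by
  have hε : 0 < α * δ := lt_of_lt_of_le hκlo hκ
  have hLeq : (geo9Y x).L = (ℓ : ℝ) + 1 := by rw [B9Ineq347Reading.geo9Y_L x]; push_cast; ring
  have hL1 : 1 ≤ (geo9Y x).L := geo9K_one_le_L x.toKIdx
  have hM0 : 0 ≤ (geo9Y x).M := B9GeoLemma21KLevelV1.geo9K_M_nonneg x.toKIdx
  have hlog0 : 0 ≤ Real.log ((ℓ : ℝ) + 1) := Real.log_nonneg (by rw [← hLeq]; exact hL1)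
  have hR1 : (1 : ℝ) ≤ 2 * ((ℓ : ℝ) + 1) ^ 2 - 1 := by nlinarith [(Nat.cast_nonneg ℓ : (0 : ℝ) ≤ ℓ)]
  set q : ℝ := -((((d : ℝ)) + 1) / 2) with hq
  have hqabs : |q| = (((d : ℝ)) + 1) / 2 := by rw [hq, abs_neg, abs_of_nonneg (by positivity)]
  have h4 : (((d : ℝ)) + 1) / 2 * Real.log ((ℓ : ℝ) + 1) ≤ κlo * (geo9Y x).M := by rw [div_le_iff₀ hκlo] at hM; linarith
  have hsize : |q| * Real.log (geo9Y x).L ≤ α * δ * (2 * ((ℓ : ℝ) + 1) ^ 2 - 1) * (geo9Y x).M := by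
    rw [hLeq, hqabs]
    calc (((d : ℝ)) + 1) / 2 * Real.log ((ℓ : ℝ) + 1) ≤ κlo * (geo9Y x).M := h4
      _ = κlo * 1 * (geo9Y x).M := by ring
      _ ≤ α * δ * (2 * ((ℓ : ℝ) + 1) ^ 2 - 1) * (geo9Y x).M := mul_le_mul_of_nonneg_right (mul_le_mul hκ hR1 zero_le_one hε.le) hM0
  have hT := B9RWSums347DefiniteFacesWindow.scaleTransfer_rpow_geo9Y x hε q hsize a a'
  rw [hLeq, hqabs] at hT
  have hc : 0 ≤ etaS x.toKIdx ^ ((((d : ℝ)) + 1) / 2) := Real.rpow_nonneg (by rw [etaS_eq_eta]; exact (geo9K_eta_pos x.toKIdx).le) _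
  rw [wcY_eq_rpow x ιB hι a, wcY_eq_rpow x ιB hι a', ← hq]
  calc Real.exp (-(α * δ * (geo9Y x).dist a a')) * (etaS x.toKIdx ^ ((((d : ℝ)) + 1) / 2) * (geo9Y x).len a' ^ q)
      = etaS x.toKIdx ^ ((((d : ℝ)) + 1) / 2) * (Real.exp (-(α * δ * (geo9Y x).dist a a')) * (geo9Y x).len a' ^ q) := by ring
    _ ≤ etaS x.toKIdx ^ ((((d : ℝ)) + 1) / 2) * (((ℓ : ℝ) + 1) ^ ((((d : ℝ)) + 1) / 2) * (geo9Y x).len a ^ q) := mul_le_mul_of_nonneg_left hT hc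
    _ = _ := by ring

end Carrier

/-! ## §1 NODE 00's structured `ℓ²` readings of `Q′`, `Q′*`, `F′`, `F′*` in the brick shapes -/

section Readings

variable (G : Subgroup 𝔸ˣ) (x : MemberY d ℓ hd hL b₀ b₁ Mstar) (par : SiteParY 𝔸 x.toKIdx) {ι : Type} [Fintype ι] (b : Module.Basis ι ℝ 𝔸)
  (ιB : BlkY x.toKIdx → IBondY x.toKIdx) {Rr : ℝ} {Hp : Prop} [Fintype (geo9Y x).Site] [DecidableEq (geo9Y x).Site]

/-- ★ **THE STRUCTURED `ℓ²` READINGS OF `Q′`, `Q′*` AT A `G`-VALUED BASE AND AT THE PRODUCT, AND OF THE (3.57) VARIATIONS**, in the shapes `hQc hQc₁ hQcs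
hQcs₁ hFc hFcs` of `B9Ineq368L2FP.ineq368_l2_FP` (constants `κ_c = κ_s = c_L(1 + C_q)`, `θ_c = θ_s = c_L·C_q`, weights `w_c`, `w_s`): gen 14's
`B9SectBKerLettersL2Y` readings at the base (contractive site transporters), the (3.57) variations under the (3.59) law supplied by g7's `CplxLettersY`
(`varParY_of_cplxLettersY`), and `Q′(U′U) = Q′(U) + F′(A)` (`qcC_prod`) for the product (`α₁ ≦ 1`). [cite: Balaban1985BackgroundPropagators, (3.19) p.393, (3.21) p.394, (3.24)–(3.25) p.394, (3.57) p.401, (3.59) p.402; Balaban1984PropagatorsII, Prop. 2.6 (2.141) p.247] -/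
theorem l2ReadingsQ_pair (hι : ∀ s : BlkY x.toKIdx, β x.toKIdx.hN x.toKIdx.D x.toKIdx.hk (ιB s) = s)
    (hG1 : ∀ u : 𝔸ˣ, u ∈ G → ‖(u : 𝔸)‖ ≤ 1) (hpar : ∀ U : CfgY 𝔸 x.toKIdx, GVal G x.toKIdx U → ∀ z w, par U z w ∈ G)
    (hsym : ∀ (U : CfgY 𝔸 x.toKIdx) (z w : SiteY x.toKIdx), par U z w = (par U w z)⁻¹)
    {M₂ : ℝ} (hM₂ : 0 ≤ M₂) (hrepr : ∀ (v : 𝔸) (j : ι), |b.repr v j| ≤ M₂ * ‖v‖) {Cq : ℝ} (hCq : 0 ≤ Cq)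
    {U : CfgY 𝔸 x.toKIdx} (hU : GVal G x.toKIdx U) {a : AfldY 𝔸 x.toKIdx} {α₁ : ℝ} (hα₁ : 0 ≤ α₁) (hα1 : α₁ ≤ 1)
    (hC : CplxLettersY G x par ιB Cq α₁ U a) :
    let cL : ℝ := Real.sqrt (Fintype.card ι) * M₂ * ∑ j, ‖b j‖
    HasL2MajorantHom (g := toB6 (geo9Y x) Rr Hp) (fun p : SiteY x.toKIdx × ι => blkC x.toKIdx ιB p.1) (fun q : BlkY x.toKIdx × ι => ιB q.1)
        (QcC x.toKIdx par b (.base U)) (fun y y' : (geo9Y x).Site => if y = y' then cL * (1 + Cq) * wcY x.toKIdx y else 0) ∧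
      HasL2MajorantHom (g := toB6 (geo9Y x) Rr Hp) (fun p : SiteY x.toKIdx × ι => blkC x.toKIdx ιB p.1) (fun q : BlkY x.toKIdx × ι => ιB q.1)
        (QcC x.toKIdx par b (.prod U a)) (fun y y' : (geo9Y x).Site => if y = y' then cL * (1 + Cq) * wcY x.toKIdx y else 0) ∧
      HasL2MajorantHom (g := toB6 (geo9Y x) Rr Hp) (fun q : BlkY x.toKIdx × ι => ιB q.1) (fun p : SiteY x.toKIdx × ι => blkC x.toKIdx ιB p.1)
        (QcsC x.toKIdx par b (.base U)) (fun y y' : (geo9Y x).Site => if y = y' then cL * (1 + Cq) * wsY x.toKIdx y else 0) ∧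
      HasL2MajorantHom (g := toB6 (geo9Y x) Rr Hp) (fun q : BlkY x.toKIdx × ι => ιB q.1) (fun p : SiteY x.toKIdx × ι => blkC x.toKIdx ιB p.1)
        (QcsC x.toKIdx par b (.prod U a)) (fun y y' : (geo9Y x).Site => if y = y' then cL * (1 + Cq) * wsY x.toKIdx y else 0) ∧
      HasL2MajorantHom (g := toB6 (geo9Y x) Rr Hp) (fun p : SiteY x.toKIdx × ι => blkC x.toKIdx ιB p.1) (fun q : BlkY x.toKIdx × ι => ιB q.1)
        (QcC x.toKIdx par b (.prod U a) - QcC x.toKIdx par b (.base U))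
        (fun y y' : (geo9Y x).Site => if y = y' then cL * Cq * α₁ * wcY x.toKIdx y else 0) ∧
      HasL2MajorantHom (g := toB6 (geo9Y x) Rr Hp) (fun q : BlkY x.toKIdx × ι => ιB q.1) (fun p : SiteY x.toKIdx × ι => blkC x.toKIdx ιB p.1)
        (QcsC x.toKIdx par b (.prod U a) - QcsC x.toKIdx par b (.base U))
        (fun y y' : (geo9Y x).Site => if y = y' then cL * Cq * α₁ * wsY x.toKIdx y else 0) := by
  intro cL
  letI : Fintype (geo9K x.toKIdx).Site := ‹Fintype (geo9Y x).Site›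
  letI : DecidableEq (geo9K x.toKIdx).Site := ‹DecidableEq (geo9Y x).Site›
  have hSb : 0 ≤ ∑ j, ‖b j‖ := Finset.sum_nonneg fun j _ => norm_nonneg _
  have hcL : 0 ≤ cL := by positivity
  have hparU : ∀ z w : SiteY x.toKIdx, ‖(par U z w : 𝔸)‖ ≤ 1 ∧ ‖(((par U z w)⁻¹ : 𝔸ˣ) : 𝔸)‖ ≤ 1 :=
    fun z w => norm_le_one_and_inv_of_mem G hG1 (hpar U hU z w)
  have hv : VarParY x.toKIdx par Cq α₁ U a := varParY_of_cplxLettersY G x par ιB hι hsym hC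
  have hcv : 0 ≤ Cq * α₁ := mul_nonneg hCq hα₁
  -- gen 14's readings at the base and of the variations
  have hQ := hasL2MajorantHom_QcC (Rr := Rr) (Hp := Hp) x.toKIdx par b ιB hι hM₂ hrepr hparU
  have hQs := hasL2MajorantHom_QcsC (Rr := Rr) (Hp := Hp) x.toKIdx par b ιB hι hM₂ hrepr hparU
  have hF := hasL2MajorantHom_FcC (Rr := Rr) (Hp := Hp) x.toKIdx par b ιB hι hM₂ hrepr hcv hv
  have hFs := hasL2MajorantHom_FcsC (Rr := Rr) (Hp := Hp) x.toKIdx par b ιB hι hM₂ hrepr hcv hv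
  have hFc_eq : QcC x.toKIdx par b (.prod U a) - QcC x.toKIdx par b (.base U) = FcC x.toKIdx par b (.base U) (.mult a) := by
    rw [qcC_prod x.toKIdx par b U a, add_sub_cancel_left]
  have hFcs_eq : QcsC x.toKIdx par b (.prod U a) - QcsC x.toKIdx par b (.base U) = FcsC x.toKIdx par b (.base U) (.mult a) := by
    rw [qcsC_prod x.toKIdx par b U a, add_sub_cancel_left]
  -- (the kernels of gen 14 carry the structural `DecidableEq` of `IBondY`, the brick shapes the geometry's: compare case by case)
  have hQ' : HasL2MajorantHom (g := toB6 (geo9Y x) Rr Hp) (fun p : SiteY x.toKIdx × ι => blkC x.toKIdx ιB p.1) (fun q : BlkY x.toKIdx × ι => ιB q.1)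
      (QcC x.toKIdx par b (.base U)) (fun y y' : (geo9Y x).Site => if y = y' then cL * (1 + Cq) * wcY x.toKIdx y else 0) :=
    hasL2MajorantHom_mono (g := toB6 (geo9Y x) Rr Hp) _ _ hQ fun y y' => mul_ite_le_ite _ _ (by
      have h3 : 0 ≤ cL * Cq * wcY x.toKIdx y := mul_nonneg (mul_nonneg hcL hCq) (wcY_nonneg x.toKIdx y)
      linarith)
  have hQs' : HasL2MajorantHom (g := toB6 (geo9Y x) Rr Hp) (fun q : BlkY x.toKIdx × ι => ιB q.1) (fun p : SiteY x.toKIdx × ι => blkC x.toKIdx ιB p.1)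
      (QcsC x.toKIdx par b (.base U)) (fun y y' : (geo9Y x).Site => if y = y' then cL * (1 + Cq) * wsY x.toKIdx y else 0) :=
    hasL2MajorantHom_mono (g := toB6 (geo9Y x) Rr Hp) _ _ hQs fun y y' => mul_ite_le_ite _ _ (by
      have h3 : 0 ≤ cL * Cq * wsY x.toKIdx y := mul_nonneg (mul_nonneg hcL hCq) (wsY_nonneg x.toKIdx y)
      linarith)
  have hF' : HasL2MajorantHom (g := toB6 (geo9Y x) Rr Hp) (fun p : SiteY x.toKIdx × ι => blkC x.toKIdx ιB p.1) (fun q : BlkY x.toKIdx × ι => ιB q.1)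
      (QcC x.toKIdx par b (.prod U a) - QcC x.toKIdx par b (.base U))
      (fun y y' : (geo9Y x).Site => if y = y' then cL * Cq * α₁ * wcY x.toKIdx y else 0) := by
    rw [hFc_eq]
    exact hasL2MajorantHom_mono (g := toB6 (geo9Y x) Rr Hp) _ _ hF fun y y' => mul_ite_le_ite _ _ (le_of_eq (by ring))
  have hFs' : HasL2MajorantHom (g := toB6 (geo9Y x) Rr Hp) (fun q : BlkY x.toKIdx × ι => ιB q.1) (fun p : SiteY x.toKIdx × ι => blkC x.toKIdx ιB p.1)
      (QcsC x.toKIdx par b (.prod U a) - QcsC x.toKIdx par b (.base U))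
      (fun y y' : (geo9Y x).Site => if y = y' then cL * Cq * α₁ * wsY x.toKIdx y else 0) := by
    rw [hFcs_eq]
    exact hasL2MajorantHom_mono (g := toB6 (geo9Y x) Rr Hp) _ _ hFs fun y y' => mul_ite_le_ite _ _ (le_of_eq (by ring))
  -- the product: `Q′(U′U) = Q′(U) + (Q′(U′U) − Q′(U))`, `α₁ ≦ 1`
  have hQ1 : HasL2MajorantHom (g := toB6 (geo9Y x) Rr Hp) (fun p : SiteY x.toKIdx × ι => blkC x.toKIdx ιB p.1) (fun q : BlkY x.toKIdx × ι => ιB q.1)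
      (QcC x.toKIdx par b (.prod U a)) (fun y y' : (geo9Y x).Site => if y = y' then cL * (1 + Cq) * wcY x.toKIdx y else 0) := by
    have e : QcC x.toKIdx par b (.prod U a) = QcC x.toKIdx par b (.base U) + (QcC x.toKIdx par b (.prod U a) - QcC x.toKIdx par b (.base U)) := by abel
    rw [e]
    refine hasL2MajorantHom_mono (g := toB6 (geo9Y x) Rr Hp) _ _ (hasL2MajorantHom_add (g := toB6 (geo9Y x) Rr Hp) _ _ hQ hF') fun y y' =>
      mul_ite_add_ite_le_ite _ _ _ ?_
    have h3 : 0 ≤ cL * Cq * wcY x.toKIdx y := mul_nonneg (mul_nonneg hcL hCq) (wcY_nonneg x.toKIdx y)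
    have h4 : cL * Cq * wcY x.toKIdx y * α₁ ≤ cL * Cq * wcY x.toKIdx y * 1 := mul_le_mul_of_nonneg_left hα1 h3
    linarith
  have hQs1 : HasL2MajorantHom (g := toB6 (geo9Y x) Rr Hp) (fun q : BlkY x.toKIdx × ι => ιB q.1) (fun p : SiteY x.toKIdx × ι => blkC x.toKIdx ιB p.1)
      (QcsC x.toKIdx par b (.prod U a)) (fun y y' : (geo9Y x).Site => if y = y' then cL * (1 + Cq) * wsY x.toKIdx y else 0) := by
    have e : QcsC x.toKIdx par b (.prod U a) = QcsC x.toKIdx par b (.base U) + (QcsC x.toKIdx par b (.prod U a) - QcsC x.toKIdx par b (.base U)) := by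
      abel
    rw [e]
    refine hasL2MajorantHom_mono (g := toB6 (geo9Y x) Rr Hp) _ _ (hasL2MajorantHom_add (g := toB6 (geo9Y x) Rr Hp) _ _ hQs hFs') fun y y' =>
      mul_ite_add_ite_le_ite _ _ _ ?_
    have h3 : 0 ≤ cL * Cq * wsY x.toKIdx y := mul_nonneg (mul_nonneg hcL hCq) (wsY_nonneg x.toKIdx y)
    have h4 : cL * Cq * wsY x.toKIdx y * α₁ ≤ cL * Cq * wsY x.toKIdx y * 1 := mul_le_mul_of_nonneg_left hα1 h3
    linarith
  exact ⟨hQ', hQ1, hQs', hQs1, hF', hFs'⟩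

end Readings

/-! ## §2 ★★★ (3.77) in block-`ℓ²` for the concrete `P₁(A)` at NODE 00's coded letters -/

section Main

variable [NormOneClass 𝔸] [FiniteDimensional ℝ 𝔸] {J : Type} (f : J → MemberY d ℓ hd hL b₀ b₁ Mstar)
  [∀ x : MemberY d ℓ hd hL b₀ b₁ Mstar, Fintype (geo9Y x).Site]
  [instDS : ∀ x : MemberY d ℓ hd hL b₀ b₁ Mstar, DecidableEq (geo9Y x).Site] [instNE : ∀ x : MemberY d ℓ hd hL b₀ b₁ Mstar, Nonempty (geo9Y x).Site]
  (c35 : ℝ) (G : Subgroup 𝔸ˣ) (par : ∀ j : J, SiteParY 𝔸 (f j).toKIdx) (parB : ∀ j : J, BondParY 𝔸 (f j).toKIdx)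
  {ι : Type} [Fintype ι] [DecidableEq ι] (b : Module.Basis ι ℝ 𝔸) (ιB : ∀ j : J, BlkY (f j).toKIdx → IBondY (f j).toKIdx)
  (C37 C38 : ∀ j : J, ℝ → CfgY 𝔸 (f j).toKIdx → AfldY 𝔸 (f j).toKIdx → Prop)

set_option maxHeartbeats 3200000 in
set_option maxRecDepth 2048 in
/-- ★★★ **(3.77) p. 406 FOR THE CONCRETE `P₁(A)`, IN BLOCK-`ℓ²`, AT NODE 00's CODED LETTERS** — the displayed law `Read377L2 (gFrame₅CodedOn …)` of gen 14's
`stepL2Pos_KACU_frame₈_on` is a THEOREM: for all inputs `(B₀, δ₀, B₁, δ₁) > 0` there are an M-threshold, an α₁-window, a constant `κ₇` and a rate `ρ₇` (before the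
member) such that at every (3.35)-regular coded base above the threshold carrying the (3.42), (3.46) blocks of `KSC` and the (3.48) kernel of
`pullS … (CinvY …)`, and every coded multiplier in (3.37) in the window, `pOneConc` at the frame's `R`-words has the block-`ℓ²` majorant `κ₇·α₁·(Lʲη)⁻²·e^{−ρ₇d}`.
Route: g6's `read377_of_l2GFrame₃` over the block carrier `BlkY × ι` (module header): the (3.46) input converted to gen 9's augmented readings `KSC₃` at rate
`δ₀/2` (plaquette law from `hreg335P`), the `G′(U′U)` block-`ℓ²` entries from `l2Frame₂CodedOn`, r06's `thm34_Gp_uniform` and `thm34_Cinv_uniform_blk` at the call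
rate, sup ⟹ `ℓ²` on `P` with `√|ι|`, (3.63) both sides, (3.65), the bricks `ineq368_l2_FP`, `ineq349_l2Hom_of_readingsP`, `ineq377_l2_concreteE`; the structured
`ℓ²` readings of `Q′, Q′*, F′, F′*` by §1 and the volume transfer of `w_c` by `transfer_wcY` (threshold `((d+1)/2)·log(ℓ+1)/((9/5000)δ_F)`).  (One long assembly:
the heartbeat limit is raised as for the template, and the recursion depth for the final unification of the bricks' word with the frame's.)
[cite: Balaban1985BackgroundPropagators, (3.77) p.406 + (3.76) p.405 + (3.49) p.399 + (3.68) p.403 + (3.57)–(3.67) pp.401–403 + Thm 3.2 (3.48) p.398 + Thm 3.1 (3.46) p.398 + Thm 3.4 p.400; Balaban1984PropagatorsII, Lemma 2.1 p.234 + (2.51) p.232 + (2.69) p.235 + Prop. 2.6 (2.140)–(2.141) p.247] -/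
theorem read377L2_gFrame₅CodedOn (hι : ∀ (j : J) (s : BlkY (f j).toKIdx), β (f j).toKIdx.hN (f j).toKIdx.D (f j).toKIdx.hk (ιB j s) = s)
    (hG1 : ∀ u : 𝔸ˣ, u ∈ G → ‖(u : 𝔸)‖ ≤ 1) (hpar : ∀ j (U : CfgY 𝔸 (f j).toKIdx), GVal G (f j).toKIdx U → ∀ z w, par j U z w ∈ G)
    (hunit : ∀ j (U : CfgY 𝔸 (f j).toKIdx), GVal G (f j).toKIdx U → IsUnit (deltaPrimeAY (f j).toKIdx (par j) U))
    (M₂ : ℝ) (hM₂ : 0 ≤ M₂) (hrepr : ∀ (v : 𝔸) (j : ι), |b.repr v j| ≤ M₂ * ‖v‖) (hcR : 0 < M₂ * ∑ j, ‖b j‖)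
    (Cq : ℝ) (hCq : 0 ≤ Cq) (hC37 : ∀ j β' U a, C37 j β' U a → GVal G (f j).toKIdx U ∧ CplxLettersY G (f j) (par j) (ιB j) Cq β' U a)
    (MInv aInv aW : ℝ) (hMInv : 0 < MInv) (haInv : 0 < aInv) (haW : 0 < aW)
    (hunitX : ∀ j (U : CfgY 𝔸 (f j).toKIdx), GVal G (f j).toKIdx U → IsUnit (XY (f j).toKIdx (par j) (GpY (f j).toKIdx (par j)) U))
    (hsym : ∀ j (U : CfgY 𝔸 (f j).toKIdx) (z w : SiteY (f j).toKIdx), par j U z w = (par j U w z)⁻¹)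
    (hunitA : ∀ j (U : CfgY 𝔸 (f j).toKIdx), GVal G (f j).toKIdx U → IsUnit (deltaAY (f j).toKIdx (par j) (parB j) (GpY (f j).toKIdx (par j)) U))
    (hparB : ∀ j (U : CfgY 𝔸 (f j).toKIdx), GVal G (f j).toKIdx U → ∀ y f', parB j U y f' ∈ G) (hb₁ : 0 ≤ b₁)
    (C₀ : ℝ) (hC₀ : 0 ≤ C₀)
    (hreg335P : ∀ j (α₀ : ℝ) (U : CfgY 𝔸 (f j).toKIdx), MInv ≤ (geo9Y (f j)).M → 0 < α₀ → (geo9Y (f j)).M * α₀ ≤ aInv →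
      (bg9Y 𝔸 G (f j)).Reg335 c35 α₀ U → Reg335PlaqY G (f j) (ιB j) C₀ U)
    (hC37G : ∀ j β' U a, C37 j β' U a → CplxLettersGY G (f j) (ιB j) β' U a)
    (cVar : ℝ) (hcVar : 0 ≤ cVar) (hvarB : ∀ j β' U a, C37 j β' U a → VarParBY (f j).toKIdx (parB j) cVar β' U a)
    (hMd : 2 * ((d : ℝ) + 1) < MInv) (mN : ℕ) (hnbr : ∀ (j : J) (y' : IBondY (f j).toKIdx), (nbr (geo9Y (f j)) (2 * ((d : ℝ) + 1)) y').card ≤ mN) :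
    Read377L2 (gFrame₅CodedOn f c35 G par parB b ιB C37 C38 hι hG1 hpar hunit M₂ hM₂ hrepr hcR Cq hCq hC37 MInv aInv aW hMInv haInv haW hunitX hsym hunitA hparB hb₁ C₀
        hC₀ hreg335P hC37G cVar hcVar hvarB hMd mN hnbr) := by
  set F := gFrame₅CodedOn f c35 G par parB b ιB C37 C38 hι hG1 hpar hunit M₂ hM₂ hrepr hcR Cq hCq hC37 MInv aInv aW hMInv haInv haW hunitX hsym hunitA hparB hb₁ C₀
        hC₀ hreg335P hC37G cVar hcVar hvarB hMd mN hnbr with hFdef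
  intro B₀ δ₀ B₁ δ₁ hB₀ hδ₀ hB₁ hδ₁
  classical
  -- the lineage's constants
  have hSb : 0 ≤ ∑ j, ‖b j‖ := Finset.sum_nonneg fun j _ => norm_nonneg _
  have hSb2 : 0 ≤ Real.sqrt (∑ j, ‖b j‖ ^ 2) := Real.sqrt_nonneg _
  have hne : Nonempty ι := by
    by_contra h
    rw [not_nonempty_iff] at h
    simp at hcR
  have hsq : 0 < Real.sqrt (Fintype.card ι : ℝ) := Real.sqrt_pos.2 (by exact_mod_cast Fintype.card_pos)
  have hcL : 0 < Real.sqrt (Fintype.card ι) * M₂ * ∑ j, ‖b j‖ := by rw [mul_assoc]; exact mul_pos hsq hcR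
  set cLY : ℝ := Real.sqrt (Fintype.card ι) * M₂ * ∑ j, ‖b j‖ with hcLY
  -- gen 9's `L²` frame at the augmented readings `KSC₃` (same root data as `F`)
  set FL := l2Frame₂CodedOn f c35 G b C37 C38 par ιB hι hG1 hpar hunit (d + 1) M₂ hM₂ hrepr hcR hcL Cq hCq hC37 MInv aInv aW hMInv haInv haW with hFLdef
  -- the G′-side input conversion: rate `δh = δ₀/2`, the `KSC₃` block constant `BL3` (before the member)
  set δh : ℝ := δ₀ / 2 with hδh
  have hδh0 : 0 < δh := by positivity
  have hδhδ₀ : δh ≤ δ₀ := by rw [hδh]; linarith only [hδ₀]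
  set Λ4 : ℝ := ((ℓ : ℝ) + 1) ^ 4 with hΛ4
  have hΛ41 : (1 : ℝ) ≤ Λ4 := one_le_pow₀ (by have : (0 : ℝ) ≤ ℓ := Nat.cast_nonneg ℓ; linarith)
  set dL0 : ℕ := d261Y (d := d) (ℓ := ℓ) (hd := hd) (hL := hL) (b₀ := b₀) (b₁ := b₁) (Mstar := Mstar) δ₀ with hdL0
  set BL3 : ℝ := cLY * max (crossConstL2 M₂ (∑ j, ‖b j‖) (Real.sqrt (Fintype.card ι)) d dL0 δ₀ Λ4 B₀)
      (cross2ConstL2 (2 * C₀) M₂ (∑ j, ‖b j‖) (Real.sqrt (Fintype.card ι)) d dL0 δ₀ Λ4 B₀) with hBL3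
  have hBL30 : 0 ≤ BL3 :=
    mul_nonneg hcL.le (le_max_of_le_left (crossConstL2_nonneg hM₂ hSb hsq.le d dL0 δ₀ Λ4 hB₀.le))
  set B₀' : ℝ := max B₀ BL3 with hB₀'
  have hB₀'0 : 0 < B₀' := lt_max_of_lt_left hB₀
  -- the block-ℓ² entries of G′(U′U) (left: members 0, 1; right: member 2) from the `L²` frame at `KSC₃`, constants BEFORE the member
  obtain ⟨a₃, ha₃, B₃, hB₃, H3⟩ := l2entries_ext_of_l2Frame₂ FL hB₀'0 hδh0
  obtain ⟨a₄, ha₄, B₄, hB₄, H4⟩ := l2rightEntries_ext_of_l2Frame₂ FL (fun j α₀ c B δ _ _ _ hreg hB _ hL2 k => by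
      obtain ⟨U, rfl, hU⟩ := (codingYx G (f j) (C37 j) (C38 j)).exists_of_bg_Reg335 hreg
      exact readL2_two_KSC₃ G (f j) (par j) (C37 j) (C38 j) b (ιB j) (hι j) hM₂ hrepr hU.1.1 hB.le hL2 k) hB₀'0 hδh0
  -- the call rate δ′ (≤ δh, δ₁, δcap and ≤ both output rates of the G′(U′U) entries) and the assembly rate δF = 9δ′/25
  set δ' : ℝ := min (F.rate (min δh δ₁)) (rateR (FL.rate δh)) with hδ'
  have hrate0 : 0 < FL.rate δh := FL.rate_pos hδh0
  have hδ'0 : 0 < δ' := lt_min (F.rate_pos (lt_min hδh0 hδ₁)) (rateR_pos hrate0)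
  have hδ'c : δ' ≤ F.δcap := le_trans (min_le_left _ _) (F.rate_le_cap _)
  have hδ'δh : δ' ≤ δh := le_trans (min_le_left _ _) (le_trans (F.rate_le _) (min_le_left _ _))
  have hδ'δ₀ : δ' ≤ δ₀ := hδ'δh.trans hδhδ₀
  have hδ'δ₁ : δ' ≤ δ₁ := le_trans (min_le_left _ _) (le_trans (F.rate_le _) (min_le_right _ _))
  have hδ'R : δ' ≤ rateR (FL.rate δh) := min_le_right _ _
  have hδ'L : δ' ≤ (1 - 1 / 100) * (49 / 50 * FL.rate δh) := by
    refine hδ'R.trans ?_; unfold rateR; nlinarith only [hrate0]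
  set δF : ℝ := 9 / 25 * δ' with hδF
  have hδF0 : 0 < δF := by positivity
  have hδFc : δF ≤ F.δcap := by rw [hδF]; nlinarith only [hδ'c, hδ'0]
  have hδFδ' : δF ≤ δ' := by rw [hδF]; nlinarith only [hδ'0]
  -- r06's uniform clauses (R1) at the call rate: G′ (for the inverse identities) and C⁻¹ OVER THE BLOCK CARRIER
  have hBG : 0 < F.cR * B₀ := mul_pos F.cR_pos hB₀
  obtain ⟨a₁, ha₁, B', -, H⟩ := thm34_Gp_uniform b (Fin (d + 1)) (F.d261 δ') δ' (F.cR * B₀) F.Cq F.a₀ F.d₀ F.M₂ (F.Λf δ')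
    hBG F.Cq_nonneg F.a₀_nonneg F.M₂_nonneg hδ'0 (fun α hα => F.Λf_one_le _ α hδ'0 hα) F.hrepr
  obtain ⟨a₂, ha₂, H'⟩ := thm34_Cinv_uniform_blk b (Fin (d + 1)) (F.d261 δ') δ' F.κQ (F.cR * B₀) (F.cK * B₁) F.cF F.Cq F.a₀ F.d₀ F.M₂ (F.Λf δ')
    F.κQ_pos hBG (mul_pos F.cK_pos hB₁) F.cF_pos F.Cq_nonneg F.a₀_nonneg F.M₂_nonneg hδ'0 (fun α hα => F.Λf_one_le _ α hδ'0 hα) F.hrepr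
  -- frame-level constants of the assembly
  set BL : ℝ := cLY * BL3 with hBL
  have hBL0 : 0 ≤ BL := mul_nonneg hcL.le hBL30
  set BG : ℝ := BL + B₃ + B₄ with hBGdef
  have hBG0 : 0 ≤ BG := by positivity
  have hBLle : BL ≤ BG := by rw [hBGdef]; linarith only [hB₃, hB₄]
  have hB₃le : B₃ ≤ BG := by rw [hBGdef]; linarith only [hBL0, hB₄]
  have hB₄le : B₄ ≤ BG := by rw [hBGdef]; linarith only [hBL0, hB₃]
  set ΘV : ℝ := 2 * BL * F.Λf δ' (1 / 100) * B6.c1 (F.d261 δ') δ' (1 / 100) *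
    cVL2 (Fintype.card (Fin (d + 1))) (Fintype.card ι) 1 1 F.a₀ F.Cq F.M₂ (∑ j, ‖b j‖) (Real.sqrt (∑ j, ‖b j‖ ^ 2)) (Real.exp (δ' * F.d₀)) with hΘV
  set ΘW : ℝ := BL * F.Λf δ' (1 / 100) * B6.c1 (F.d261 δ') δ' (1 / 100) *
    (cVL2 (Fintype.card (Fin (d + 1))) (Fintype.card ι) 1 1 F.a₀ F.Cq F.M₂ (∑ j, ‖b j‖) (Real.sqrt (∑ j, ‖b j‖ ^ 2)) (Real.exp (δ' * F.d₀)) +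
      2 * Fintype.card (Fin (d + 1)) * (2 * (1 : ℝ) ^ 2 * F.M₂ * (∑ j, ‖b j‖) * Real.sqrt ((1 * Fintype.card ι : ℕ) : ℝ) * Real.exp (δ' * F.d₀))) with hΘW
  have hΛ'1 : 1 ≤ F.Λf δ' (1 / 100) := F.Λf_one_le δ' _ hδ'0 (by norm_num)
  have hΛ'0 : 0 ≤ F.Λf δ' (1 / 100) := zero_le_one.trans hΛ'1
  have hcV1 : 0 ≤ cVL2 (Fintype.card (Fin (d + 1))) (Fintype.card ι) 1 1 F.a₀ F.Cq F.M₂ (∑ j, ‖b j‖) (Real.sqrt (∑ j, ‖b j‖ ^ 2)) (Real.exp (δ' * F.d₀)) :=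
    cVL2_nonneg (d := Fintype.card (Fin (d + 1))) (nι := Fintype.card ι) (ρu := 1) zero_le_one F.a₀_nonneg F.Cq_nonneg F.M₂_nonneg hSb hSb2
      (Real.exp_nonneg (δ' * F.d₀))
  have hc1' : 0 ≤ B6.c1 (F.d261 δ') δ' (1 / 100) := B6RandomWalk.c1_nonneg (F.d261 δ') δ' (1 / 100)
  have hΘV0 : 0 ≤ ΘV := by rw [hΘV]; positivity
  have hΘW0 : 0 ≤ ΘW := by have := F.M₂_nonneg; rw [hΘW]; positivity
  set BC : ℝ := Real.sqrt (Fintype.card ι) * (F.cK * B₁) with hBC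
  have hBC0 : 0 ≤ BC := mul_nonneg hsq.le (mul_pos F.cK_pos hB₁).le
  set BC' : ℝ := Real.sqrt (Fintype.card ι) * (2 * (F.cK * B₁) * B6.c1 (F.d261 δ') (2 / 5 * δ') (1 / 10)) with hBC'
  have hBC'' : 0 ≤ 2 * (F.cK * B₁) * B6.c1 (F.d261 δ') (2 / 5 * δ') (1 / 10) := by
    have := B6RandomWalk.c1_nonneg (F.d261 δ') (2 / 5 * δ') (1 / 10); have := mul_pos F.cK_pos hB₁; positivity
  have hBC'0 : 0 ≤ BC' := mul_nonneg hsq.le hBC''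
  set ΛF : ℝ := F.Λf δF (1 / 100) with hΛF
  have hΛF1 : 1 ≤ ΛF := F.Λf_one_le δF _ hδF0 (by norm_num)
  set cFL : ℝ := B6.c1 (F.d261 δF) δF (1 / 100) with hcFL
  have hcFL0 : 0 ≤ cFL := B6RandomWalk.c1_nonneg _ _ _
  set ΛC0 : ℝ := ((ℓ : ℝ) + 1) ^ ((((d : ℝ)) + 1) / 2) with hΛC0
  have hΛC00 : 0 ≤ ΛC0 := Real.rpow_nonneg (by have : (0 : ℝ) ≤ ℓ := Nat.cast_nonneg ℓ; linarith) _
  -- the structured-reading constants of §1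
  set κc : ℝ := cLY * (1 + Cq) with hκc
  set θc : ℝ := cLY * Cq with hθc
  have hκc0 : 0 ≤ κc := by rw [hκc]; positivity
  have hθc0 : 0 ≤ θc := by rw [hθc]; positivity
  -- the (3.68) and (3.49) constants and the (3.77) constant at α₁ = 1
  set KPp : ℝ := (1 + Fintype.card (Fin (d + 1))) * kappa368F (F.Λf δF (1 / 100)) (B6.c1 (F.d261 δF) δF (1 / 100)) ΛC0 ΛC0 ΛC0 κc κc θc θc BG ΘV ΘW BC BC'
    with hKPp
  set KP : ℝ := (1 + Real.sqrt (Fintype.card (Fin (d + 1)))) * kappa349 1 BG (κc * κc * BC * ΛC0) ΛF cFL with hKP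
  have hKP0 : 0 ≤ KP := by rw [hKP]; unfold kappa349; positivity
  have hKPp0 : 0 ≤ KPp := by
    rw [hKPp]
    have hcard : (0 : ℝ) ≤ Fintype.card (Fin (d + 1)) := Nat.cast_nonneg _
    have : 0 ≤ kappa368F (F.Λf δF (1 / 100)) (B6.c1 (F.d261 δF) δF (1 / 100)) ΛC0 ΛC0 ΛC0 κc κc θc θc BG ΘV ΘW BC BC' := by
      have := zero_le_one.trans hΛF1
      unfold kappa368F B9Ineq368L2F.thetaM B9Ineq368L2F.thetaI B9Ineq368L2F.thetaC; positivity
    positivity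
  set cE : ℝ := Real.sqrt (((Fintype.card (Fin (d + 1)) + 1) * Fintype.card ι : ℕ) : ℝ) * (4 * (1 + Fintype.card (Fin (d + 1))) * (F.M₂ * ∑ j, ‖b j‖) *
    Real.exp (21 / 25 * δF * F.d₀)) with hcE
  have hcE0 : 0 ≤ cE := by rw [hcE]; have := F.M₂_nonneg; positivity
  set κ₇ : ℝ := kappa377 cE KP KPp ΛF cFL 1 with hκ₇
  have hκ₇0 : 0 ≤ κ₇ := kappa377_nonneg hcE0 hKP0 hKPp0 (zero_le_one.trans hΛF1) hcFL0 zero_le_one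
  -- thresholds and the α₁-window
  set a : ℝ := min (min a₁ a₂) (min (min a₃ a₄) (1 / 4)) with ha_def
  have ha0 : 0 < a := lt_min (lt_min ha₁ ha₂) (lt_min (lt_min ha₃ ha₄) (by norm_num))
  set MC : ℝ := (((d : ℝ)) + 1) / 2 * Real.log ((ℓ : ℝ) + 1) / (9 / 5000 * δF) with hMC
  refine ⟨max (max (max (F.Mthr δ') (F.Mthr δF)) (FL.Mthr (FL.rate δh)))
      (max (max (M261Y (d := d) (ℓ := ℓ) (hd := hd) (hL := hL) (b₀ := b₀) (b₁ := b₁) (Mstar := Mstar) δ₀) (4 * Real.log ((ℓ : ℝ) + 1) / (δ₀ / 12))) MC),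
    a, κ₇, 4 / 5 * δF, lt_max_of_lt_left (lt_max_of_lt_left (lt_max_of_lt_left (F.Mthr_pos _))), ha0, hκ₇0, by positivity, ?_⟩
  intro i α₀ U hM0 hα₀ hMa hU hE hL2 hKer α₁ U' hα₁ ha hU'
  have hM' : F.Mthr δ' ≤ (geo9Y (f i)).M := le_trans (le_trans (le_trans (le_max_left _ _) (le_max_left _ _)) (le_max_left _ _)) hM0
  have hMF : F.Mthr δF ≤ (geo9Y (f i)).M := le_trans (le_trans (le_trans (le_max_right _ _) (le_max_left _ _)) (le_max_left _ _)) hM0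
  have hM3 : FL.Mthr (FL.rate δh) ≤ (geo9Y (f i)).M := le_trans (le_trans (le_max_right _ _) (le_max_left _ _)) hM0
  have hM261 : M261Y (d := d) (ℓ := ℓ) (hd := hd) (hL := hL) (b₀ := b₀) (b₁ := b₁) (Mstar := Mstar) δ₀ ≤ (geo9Y (f i)).M :=
    le_trans (le_trans (le_trans (le_max_left _ _) (le_max_left _ _)) (le_max_right _ _)) hM0
  have hMST : 4 * Real.log ((ℓ : ℝ) + 1) / (δ₀ / 12) ≤ (geo9Y (f i)).M :=
    le_trans (le_trans (le_trans (le_max_right _ _) (le_max_left _ _)) (le_max_right _ _)) hM0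
  have hMCle : MC ≤ (geo9Y (f i)).M := le_trans (le_trans (le_max_right _ _) (le_max_right _ _)) hM0
  have hM : F.MInv ≤ (geo9Y (f i)).M := F.MInv_le_of_Mthr_le hM'
  have ha1 : α₁ ≤ a₁ := ha.trans ((min_le_left _ _).trans (min_le_left _ _))
  have ha2 : α₁ ≤ a₂ := ha.trans ((min_le_left _ _).trans (min_le_right _ _))
  have ha3 : α₁ ≤ a₃ := ha.trans ((min_le_right _ _).trans ((min_le_left _ _).trans (min_le_left _ _)))
  have ha4 : α₁ ≤ a₄ := ha.trans ((min_le_right _ _).trans ((min_le_left _ _).trans (min_le_right _ _)))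
  have haq : α₁ ≤ 1 / 4 := ha.trans ((min_le_right _ _).trans (min_le_right _ _))
  have hα1 : α₁ ≤ 1 := haq.trans (by norm_num)
  have hw2 : ∀ a : (geo9Y (f i)).Site, 0 ≤ (geo9Y (f i)).len a ^ 2 := fun a => sq_nonneg _
  have hw1 : ∀ a : (geo9Y (f i)).Site, 0 ≤ (geo9Y (f i)).len a := fun a => (F.len_pos i a).le
  -- decoding the configurations: `U = base V`, `U′ = mult aa` (the coded classes live at such pairs only)
  obtain ⟨V, rfl, hV335⟩ := (codingYx G (f i) (C37 i) (C38 i)).exists_of_bg_Reg335 hU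
  obtain ⟨V₁, aa, hVV, rfl, hC1⟩ := (codingYx G (f i) (C37 i) (C38 i)).exists_of_bg_Cplx337 hU'
  have hVV' : V = V₁ := by injection hVV
  subst hVV'
  set U : (codingYx G (f i) (C37 i) (C38 i)).bg.Cfg := CCfg.base V with hUdef
  set U' : (codingYx G (f i) (C37 i) (C38 i)).bg.Cfg := CCfg.mult aa with hU'def
  have hVval : GVal G (f i).toKIdx V := hV335.1.1
  -- ★ the G′-side input at U converted to the augmented readings `KSC₃` (Lemma 2.1, p. 398 transfers, the plaquette law)
  have hL2rec := l2Block_record_of_KSC_base (f i) G (par i) (C37 i) (C38 i) hL2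
  have h261₀ := d261Y_spec (f i) hδ₀ (by norm_num : (9 : ℝ) / 5000 ≤ 1 / 12) (by norm_num) hM261
  have hκlo₀ : 0 < δ₀ / 12 := by positivity
  obtain ⟨hT1₀, -, -, hT2i₀, -, -⟩ := scaleTransfer6_window_geo9Y hκlo₀ (f i) (δ := δ₀) (α := 1 / 12) (by linarith only [hδ₀]) hMST
  have hTi2₀ : ScaleTransfer (geo9Y (f i)) δ₀ (1 / 12) Λ4 (fun a => ((geo9Y (f i)).len a)⁻¹ ^ 2) := by
    have e : (fun a => ((geo9Y (f i)).len a)⁻¹ ^ 2) = (fun a => ((geo9Y (f i)).len a ^ 2)⁻¹) := funext fun a => by rw [inv_pow]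
    rw [e]; exact hT2i₀
  have hplaq := plaqLawY_of_reg335PlaqY G (f i) (ιB i) hG1 hVval hC₀ (hreg335P i α₀ V hM hα₀ hMa hV335)
  have hC₀2 : 0 ≤ 2 * C₀ := by positivity
  have hK3 : L2Block (KSC₃ G (f i) (par i) (C37 i) (C38 i)) BL3 δh U :=
    l2Block_KSC₃_base_of_record G (f i) (par i) b (ιB i) (C37 i) (C38 i) (hι i) hG1 hM₂ hrepr hδ₀ h261₀ hΛ41 hT1₀ hTi2₀ hC₀2 hB₀.le hVval
      hplaq hL2rec
  have hE3 : EBlock (KSC₃ G (f i) (par i) (C37 i) (C38 i)) B₀' δh U :=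
    (eBlock_KSC₃_iff G (f i) (par i) (C37 i) (C38 i) B₀' δh U).2 (eBlock_weaken (f i) _ hB₀.le (le_max_left _ _) hδhδ₀ hE)
  have hK3' : L2Block (KSC₃ G (f i) (par i) (C37 i) (C38 i)) B₀' δh U := l2Block_weaken (f i) _ hBL30 (le_max_right _ _) le_rfl hK3
  -- Theorem 3.1's `L²` members of G′ at U in the frame shapes (constant `BL`, rate `δh`) and the entries of G′(U′U)
  obtain ⟨l0, l1⟩ := readL2_KSC₃ G (f i) (par i) (C37 i) (C38 i) b (ιB i) (hι i) hM₂ hrepr hVval hBL30 hK3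
  have r2 := readL2_two_KSC₃ G (f i) (par i) (C37 i) (C38 i) b (ιB i) (hι i) hM₂ hrepr hVval hBL30 hK3
  -- the letters of the member ARE the frame's (by `rfl`); restate the readings in the frame's terms
  have eG : GopC (f i).toKIdx (par i) b (.base V) = F.Gop i U := rfl
  have eco : coordC G (f i).toKIdx (.base V) = F.coord i U := rfl
  have eT : Node00.shiftY (f i).toKIdx = F.T i := rfl
  rw [eG] at l0
  rw [eG, eco, eT] at l1 r2
  obtain ⟨e0, e1⟩ := H3 i α₀ U hM3 hα₀ hMa hU hE3 hK3' α₁ U' hα₁ ha3 hU'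
  have e2 := H4 i α₀ U hM3 hα₀ hMa hU hE3 hK3' α₁ U' hα₁ ha4 hU'
  have hδFδh : δF ≤ δh := hδFδ'.trans hδ'δh
  have hδFL : δF ≤ (1 - 1 / 100) * (49 / 50 * FL.rate δh) := hδFδ'.trans hδ'L
  have hδFR : δF ≤ rateR (FL.rate δh) := hδFδ'.trans hδ'R
  -- the letters at U: inverse identities, sup readings for r06, the class (3.37), (3.57)
  obtain ⟨hΔG, hGΔ⟩ := F.reg_inv i α₀ U hM hα₀ hMa hU
  obtain ⟨h1, h2, h3, -⟩ := F.read342_le i α₀ U hM hα₀ hMa hU hB₀ hδ₀ hδ'δ₀ hE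
  obtain ⟨hkF, hsF, h337s, h337F, h337B, hA, hAτ⟩ := F.cplx i α₁ U U' hα₁ hU'
  obtain ⟨hQm, hQsm⟩ := F.q_mul i α₁ U U' hα₁ hU'
  obtain ⟨hFc, hFcs⟩ := F.hF i α₁ U U' hα₁ hU'
  -- the G′ clause: the family's G′(U′U) is r06's extension
  obtain ⟨hinv1, hinv2, -, -⟩ := H (F.T i) (F.coord i U) (F.blk i) (F.kQ i U) (F.sQ i U) (F.cfun i) (F.w i U)
    (F.dist_nonneg i) (F.triangle i) (F.dist_self i) (F.dist_comm i) (F.len_pos i) (F.eta_le_len i) (F.eta_pos i)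
    (F.h261_of i hδ'0 hδ'c hM') (F.hST_of i hδ'0 hδ'c hM') (F.unitary i U)
    (F.stencilB i) (F.stencilF i) (F.stencil0 i) (F.w_nonneg i U) (F.card_w i U) (F.hkQ i U) (F.hsQ i U) (F.hcfun i)
    hΔG hGΔ h1 h2 h3 α₁ hα₁.le ha1 (F.expA i U U') (F.kF i U U') (F.sF i U U')
    hkF hsF h337s h337F h337B hA hAτ
  have hG := F.gop_eq i ((codingYx G (f i) (C37 i) (C38 i)).bg.mul U' U) _ _ (F.mul_law i α₁ U U' hα₁ hU') hinv1 hinv2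
  -- the C⁻¹ clause OVER THE BLOCK CARRIER: the (3.48) kernel at U read as a block majorant (lowered to δ′), r06's inverse at U′U with its block majorant
  have hK := F.readKer i α₀ U B₁ δ₁ hM hα₀ hMa hU hB₁ hδ₁ hKer
  have hK' : HasMajorant (g := toB6 (geo9Y (f i)) (F.Rr i) (F.Hp i)) (F.blkP i) (F.Cop i U)
      (fun a a' => F.cK * B₁ * (geo9Y (f i)).len a ^ (-(4 : ℝ)) * Real.exp (-(δ' * (geo9Y (f i)).dist a a'))) := by
    refine hasMajorant_mono (g := toB6 (geo9Y (f i)) (F.Rr i) (F.Hp i)) (F.blkP i) hK fun a a' => ?_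
    refine mul_le_mul_of_nonneg_left (Real.exp_le_exp.2 ?_) ?_
    · nlinarith only [F.dist_nonneg i a a', hδ'δ₁]
    · exact mul_nonneg (mul_pos F.cK_pos hB₁).le (Real.rpow_nonneg (F.len_pos i a).le _)
  obtain ⟨Tinv, hT1, hT2, hker⟩ := H' (F.T i) (F.coord i U) (F.blk i) (F.blkP i) (F.kQ i U) (F.sQ i U) (F.cfun i) (F.w i U)
    (F.dist_nonneg i) (F.triangle i) (F.dist_self i) (F.dist_comm i) (F.len_pos i) (F.eta_le_len i) (F.eta_pos i)
    (F.h261_of i hδ'0 hδ'c hM') (F.hST_of i hδ'0 hδ'c hM') (F.unitary i U)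
    (F.stencilB i) (F.stencilF i) (F.stencil0 i) (F.w_nonneg i U) (F.card_w i U) (F.hkQ i U) (F.hsQ i U) (F.hcfun i)
    h1 h2 (F.hQc i α₀ U hM hα₀ hMa hU) (F.hQcs i α₀ U hM hα₀ hMa hU) (F.reg_cinv i α₀ U hM hα₀ hMa hU) hK' α₁ hα₁.le ha2
    (F.expA i U U') (F.kF i U U') (F.sF i U U') hkF hsF h337s hA hAτ hQm hQsm hFc hFcs
  rw [← hG] at hT1 hT2
  have hC := F.cop_eq i ((codingYx G (f i) (C37 i) (C38 i)).bg.mul U' U) _ Tinv rfl hT1 hT2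
  rw [← hC] at hker hT1
  -- block-ℓ² majorants of C⁻¹(U), C⁻¹(U′U) on `P` at the assembly rate (sup ⟹ ℓ² with `√|ι|`)
  have hw4i : ∀ a : (geo9Y (f i)).Site, 0 ≤ ((geo9Y (f i)).len a ^ 4)⁻¹ := fun a => inv_nonneg.mpr (by positivity)
  have h348F : HasL2Majorant (g := toB6 (geo9Y (f i)) (F.Rr i) (F.Hp i)) (F.blkP i) (F.Cop i U)
      (fun a a' => BC * ((geo9Y (f i)).len a ^ 4)⁻¹ * Real.exp (-(δF * (geo9Y (f i)).dist a a'))) := by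
    have h := hasL2Majorant_blkP_of_hasMajorant (f i) (ιB i) (Rr := F.Rr i) (Hp := F.Hp i) (hι i) (mul_pos F.cK_pos hB₁).le hK'
    refine hasL2Majorant_mono (g := toB6 (geo9Y (f i)) (F.Rr i) (F.Hp i)) _ h fun a a' => ?_
    have hE' : Real.exp (-(δ' * (geo9Y (f i)).dist a a')) ≤ Real.exp (-(δF * (geo9Y (f i)).dist a a')) :=
      Real.exp_le_exp.2 (neg_le_neg (mul_le_mul_of_nonneg_right hδFδ' (F.dist_nonneg i a a')))
    calc Real.sqrt (Fintype.card ι) * (F.cK * B₁) * ((geo9Y (f i)).len a ^ 4)⁻¹ * Real.exp (-(δ' * (geo9Y (f i)).dist a a'))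
        ≤ Real.sqrt (Fintype.card ι) * (F.cK * B₁) * ((geo9Y (f i)).len a ^ 4)⁻¹ * Real.exp (-(δF * (geo9Y (f i)).dist a a')) :=
          mul_le_mul_of_nonneg_left hE' (mul_nonneg hBC0 (hw4i a))
      _ = _ := by rw [hBC]
  have h348F' : HasL2Majorant (g := toB6 (geo9Y (f i)) (F.Rr i) (F.Hp i)) (F.blkP i) (F.Cop i ((codingYx G (f i) (C37 i) (C38 i)).bg.mul U' U))
      (fun a a' => BC' * ((geo9Y (f i)).len a ^ 4)⁻¹ * Real.exp (-(δF * (geo9Y (f i)).dist a a'))) := by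
    have h := hasL2Majorant_blkP_of_hasMajorant (f i) (ιB i) (Rr := F.Rr i) (Hp := F.Hp i) (hι i) hBC'' hker
    refine hasL2Majorant_mono (g := toB6 (geo9Y (f i)) (F.Rr i) (F.Hp i)) _ h fun a a' => le_of_eq ?_
    rw [hBC', hδF]
  -- the G′ entries lowered to the assembly rate and raised to the common constant `BG`
  have low := fun (A : ℝ) (w : (geo9Y (f i)).Site → ℝ) (hA : 0 ≤ A) (hw : ∀ a, 0 ≤ w a) {ρ r : ℝ} (h : ρ ≤ r)
      {T₀ : Module.End ℝ (SiteY (f i).toKIdx × ι → ℝ)}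
      (hT : HasL2Majorant (g := toB6 (geo9Y (f i)) (F.Rr i) (F.Hp i)) (fun p : SiteY (f i).toKIdx × ι => F.blk i p.1) T₀
        (fun a a' => A * w a * Real.exp (-(r * (geo9Y (f i)).dist a a')))) =>
    hasL2Majorant_rate_mono (R := F.Rr i) (H := F.Hp i) (fun p : SiteY (f i).toKIdx × ι => F.blk i p.1) A w hA hw h (F.dist_nonneg i) hT
  have up := fun {A : ℝ} (w : (geo9Y (f i)).Site → ℝ) (hw : ∀ a, 0 ≤ w a) (hA : A ≤ BG) {r : ℝ} {T₀ : Module.End ℝ (SiteY (f i).toKIdx × ι → ℝ)}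
      (hT : HasL2Majorant (g := toB6 (geo9Y (f i)) (F.Rr i) (F.Hp i)) (fun p : SiteY (f i).toKIdx × ι => F.blk i p.1) T₀
        (fun a a' => A * w a * Real.exp (-(r * (geo9Y (f i)).dist a a')))) =>
    hasL2Majorant_mono (g := toB6 (geo9Y (f i)) (F.Rr i) (F.Hp i)) _ hT fun a a' =>
      mul_le_mul_of_nonneg_right (mul_le_mul_of_nonneg_right hA (hw a)) (Real.exp_nonneg _)
  have g0m := up (fun a => (geo9Y (f i)).len a ^ 2) hw2 hBLle (low BL (fun a => (geo9Y (f i)).len a ^ 2) hBL0 hw2 hδFδh l0)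
  have g1m := fun μ : Fin (d + 1) => up (fun a => (geo9Y (f i)).len a) hw1 hBLle (low BL (fun a => (geo9Y (f i)).len a) hBL0 hw1 hδFδh (l1 (Sum.inl μ)))
  have g2m := fun ν : Fin (d + 1) => up (fun a => (geo9Y (f i)).len a) hw1 hBLle (low BL (fun a => (geo9Y (f i)).len a) hBL0 hw1 hδFδh (r2 (Sum.inr ν)))
  have hGt0 := up (fun a => (geo9Y (f i)).len a ^ 2) hw2 hB₃le (low B₃ (fun a => (geo9Y (f i)).len a ^ 2) hB₃ hw2 hδFL e0)
  have hGt1 := fun μ : Fin (d + 1) => up (fun a => (geo9Y (f i)).len a) hw1 hB₃le (low B₃ (fun a => (geo9Y (f i)).len a) hB₃ hw1 hδFL (e1 (Sum.inl μ)))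
  have hGt2 := fun ν : Fin (d + 1) => up (fun a => (geo9Y (f i)).len a) hw1 hB₄le (low B₄ (fun a => (geo9Y (f i)).len a) hB₄ hw1 hδFR (e2 (Sum.inr ν)))
  -- the block-ℓ² (3.63) both sides at the call rate δ′ (inputs lowered to δ′, output 49δ′/50 ≥ δF)
  have l0' := low BL (fun a => (geo9Y (f i)).len a ^ 2) hBL0 hw2 hδ'δh l0
  have l1' := fun k => low BL (fun a => (geo9Y (f i)).len a) hBL0 hw1 hδ'δh (l1 k)
  have r2' := fun k => low BL (fun a => (geo9Y (f i)).len a) hBL0 hw1 hδ'δh (r2 k)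
  have h261β : Ineq261 (F.d261 δ') (toB6 (geo9Y (f i)) (F.Rr i) (F.Hp i)) δ' (1 / 100) :=
    F.h261_of i hδ'0 hδ'c hM' (1 / 100) (by norm_num) (by norm_num)
  obtain ⟨sT1, sT2, sT1i, sT2i, -, -⟩ := F.hST_of i hδ'0 hδ'c hM' (1 / 100) (by norm_num)
  have hsmall4 : ∀ y : (geo9Y (f i)).Site, (geo9Y (f i)).eta * (α₁ * ((geo9Y (f i)).len y)⁻¹) ≤ 1 / 4 := by
    intro y
    have hl := F.len_pos i y
    have h1 : (geo9Y (f i)).eta * ((geo9Y (f i)).len y)⁻¹ ≤ 1 := by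
      rw [← div_eq_mul_inv]; exact (div_le_one hl).mpr (F.eta_le_len i y)
    calc (geo9Y (f i)).eta * (α₁ * ((geo9Y (f i)).len y)⁻¹) = α₁ * ((geo9Y (f i)).eta * ((geo9Y (f i)).len y)⁻¹) := by ring
      _ ≤ α₁ * 1 := mul_le_mul_of_nonneg_left h1 hα₁.le
      _ ≤ 1 / 4 := by rw [mul_one]; exact haq
  have hr : 49 / 50 * δ' + (1 / 100 + 1 / 100) * δ' ≤ δ' := by nlinarith only [hδ'0]
  have hW := ineq363_l2_vPrime (Rr := F.Rr i) (H := F.Hp i) b (F.T i) (F.coord i U) (F.blk i) (F.d261 δ') (F.eta_pos i)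
    (F.expA i U U') (F.kQ i U) (F.kF i U U') (F.sQ i U) (F.sF i U U') (F.cfun i) (F.w i U) 1 F.d₀ F.M₂ F.Cq F.a₀
    δ' δ' (1 / 100) (1 / 100) (49 / 50 * δ') (F.Λf δ' (1 / 100)) BL α₁
    hBL0 hα₁.le hΛ'0 (by positivity) (by norm_num) (by norm_num) hδ'0.le hδ'0.le hr
    (F.dist_nonneg i) (F.triangle i) (F.len_pos i) h261β sT1 sT2 F.M₂_nonneg F.hrepr hsmall4
    (fun μ x => ⟨hA μ x, hAτ μ μ x⟩) (fun μ x => h337s μ μ x) (fun μ x => F.unitary i U μ x)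
    (fun μ x => ⟨F.stencilF i μ x, F.stencilB i μ x⟩) (F.stencil0 i)
    (F.w_nonneg i U) (F.card_w i U) F.Cq_nonneg F.a₀_nonneg (F.hkQ i U) hkF (F.hsQ i U) hsF (F.hcfun i) l0' l1'
  have hMV := hasL2Majorant_gp_vPrime (Rr := F.Rr i) (H := F.Hp i) b (F.T i) (F.coord i U) (F.blk i) (F.d261 δ') (F.eta_pos i)
    (F.expA i U U') (F.kQ i U) (F.kF i U U') (F.sQ i U) (F.sF i U U') (F.cfun i) (F.w i U) 1 F.d₀ F.M₂ F.Cq F.a₀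
    δ' δ' (1 / 100) (1 / 100) (49 / 50 * δ') (F.Λf δ' (1 / 100)) BL α₁
    hBL0 hα₁.le hΛ'0 (by positivity) (by norm_num) (by norm_num) hδ'0.le hδ'0.le hr
    (F.dist_nonneg i) (F.triangle i) (F.len_pos i) h261β sT1i sT2i F.M₂_nonneg F.hrepr hsmall4
    (fun μ x => ⟨hA μ x, hAτ μ μ x⟩) (fun μ x => h337s μ μ x) (fun μ x => h337F μ μ x) h337B (fun μ x => F.unitary i U μ x)
    (fun μ x => ⟨F.stencilF i μ x, F.stencilB i μ x⟩) (F.stencil0 i)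
    (F.w_nonneg i U) (F.card_w i U) F.Cq_nonneg F.a₀_nonneg (F.hkQ i U) hkF (F.hsQ i U) hsF (F.hcfun i) l0' r2'
  -- θ ≤ Θ·α₁ on both sides (cVL2 monotone in α₁ ≤ 1), then lowered to δF
  have hcv := cVL2_le_one (dκ := Fintype.card (Fin (d + 1))) (nι := Fintype.card ι) (E₀ := Real.exp (δ' * F.d₀)) hα1 F.a₀_nonneg
    F.Cq_nonneg F.M₂_nonneg hSb hSb2 (Real.exp_nonneg _)
  have hρF : δF ≤ 49 / 50 * δ' := by rw [hδF]; nlinarith only [hδ'0]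
  have hVG : HasL2Majorant (g := toB6 (geo9Y (f i)) (F.Rr i) (F.Hp i)) (fun p : SiteY (f i).toKIdx × ι => F.blk i p.1)
      (conj b (vPrimeConc (F.T i) (F.coord i U) (geo9Y (f i)).eta (F.expA i U U') (F.blk i) (F.kQ i U) (F.kF i U U') (F.sQ i U)
        (F.sF i U U') (F.cfun i)) * F.Gop i U) (fun a a' => ΘV * α₁ * Real.exp (-(δF * (geo9Y (f i)).dist a a'))) := by
    refine hasL2Majorant_mono (g := toB6 (geo9Y (f i)) (F.Rr i) (F.Hp i)) _ hW fun a a' => ?_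
    have hpre : 0 ≤ 2 * BL * F.Λf δ' (1 / 100) * B6.c1 (F.d261 δ') δ' (1 / 100) := by positivity
    have hθ : 2 * BL * F.Λf δ' (1 / 100) * B6.c1 (F.d261 δ') δ' (1 / 100) *
        cVL2 (Fintype.card (Fin (d + 1))) (Fintype.card ι) 1 α₁ F.a₀ F.Cq F.M₂ (∑ j, ‖b j‖) (Real.sqrt (∑ j, ‖b j‖ ^ 2)) (Real.exp (δ' * F.d₀)) ≤ ΘV := by
      rw [hΘV]; exact mul_le_mul_of_nonneg_left hcv hpre
    have hE' : Real.exp (-(49 / 50 * δ' * (geo9Y (f i)).dist a a')) ≤ Real.exp (-(δF * (geo9Y (f i)).dist a a')) :=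
      Real.exp_le_exp.2 (neg_le_neg (mul_le_mul_of_nonneg_right hρF (F.dist_nonneg i a a')))
    calc _ ≤ ΘV * α₁ * Real.exp (-(49 / 50 * δ' * (geo9Y (f i)).dist a a')) :=
          mul_le_mul_of_nonneg_right (mul_le_mul_of_nonneg_right hθ hα₁.le) (Real.exp_nonneg _)
      _ ≤ _ := mul_le_mul_of_nonneg_left hE' (mul_nonneg hΘV0 hα₁.le)
  have hGV : HasL2Majorant (g := toB6 (geo9Y (f i)) (F.Rr i) (F.Hp i)) (fun p : SiteY (f i).toKIdx × ι => F.blk i p.1)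
      (F.Gop i U * conj b (vPrimeConc (F.T i) (F.coord i U) (geo9Y (f i)).eta (F.expA i U U') (F.blk i) (F.kQ i U) (F.kF i U U') (F.sQ i U)
        (F.sF i U U') (F.cfun i))) (fun a a' => ΘW * α₁ * Real.exp (-(δF * (geo9Y (f i)).dist a a'))) := by
    refine hasL2Majorant_mono (g := toB6 (geo9Y (f i)) (F.Rr i) (F.Hp i)) _ hMV fun a a' => ?_
    have hpre : 0 ≤ BL * F.Λf δ' (1 / 100) * B6.c1 (F.d261 δ') δ' (1 / 100) := by positivity
    have hθ : BL * F.Λf δ' (1 / 100) * B6.c1 (F.d261 δ') δ' (1 / 100) *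
        (cVL2 (Fintype.card (Fin (d + 1))) (Fintype.card ι) 1 α₁ F.a₀ F.Cq F.M₂ (∑ j, ‖b j‖) (Real.sqrt (∑ j, ‖b j‖ ^ 2)) (Real.exp (δ' * F.d₀)) +
          2 * Fintype.card (Fin (d + 1)) * (2 * (1 : ℝ) ^ 2 * F.M₂ * (∑ j, ‖b j‖) * Real.sqrt ((1 * Fintype.card ι : ℕ) : ℝ) * Real.exp (δ' * F.d₀))) ≤
        ΘW := by
      rw [hΘW]; exact mul_le_mul_of_nonneg_left (add_le_add hcv le_rfl) hpre
    have hE' : Real.exp (-(49 / 50 * δ' * (geo9Y (f i)).dist a a')) ≤ Real.exp (-(δF * (geo9Y (f i)).dist a a')) :=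
      Real.exp_le_exp.2 (neg_le_neg (mul_le_mul_of_nonneg_right hρF (F.dist_nonneg i a a')))
    calc _ ≤ ΘW * α₁ * Real.exp (-(49 / 50 * δ' * (geo9Y (f i)).dist a a')) :=
          mul_le_mul_of_nonneg_right (mul_le_mul_of_nonneg_right hθ hα₁.le) (Real.exp_nonneg _)
      _ ≤ _ := mul_le_mul_of_nonneg_left hE' (mul_nonneg hΘW0 hα₁.le)
  -- (3.65): the resolvent identities of the family's own G′(U′U)
  have h365 := eq365_of_inverse hΔG hinv2
  have h365' := eq365_first_of_inverse hGΔ hinv1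
  rw [← hG] at h365 h365'
  -- Lemma 2.1 and the transfers at the assembly rate; the volume transfer of `w_c`
  have h261F := F.h261_of i hδF0 hδFc hMF
  have hSTF : ∀ α : ℝ, 9 / 5000 ≤ α →
      ScaleTransfer (geo9Y (f i)) δF α (F.Λf δF α) (fun a => (geo9Y (f i)).len a) ∧
        ScaleTransfer (geo9Y (f i)) δF α (F.Λf δF α) (fun a => (geo9Y (f i)).len a ^ 2) ∧
        ScaleTransfer (geo9Y (f i)) δF α (F.Λf δF α) (fun a => ((geo9Y (f i)).len a ^ 4)⁻¹) := by
    intro α hα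
    obtain ⟨t1, t2, -, -, t4, -⟩ := F.hST_of i hδF0 hδFc hMF α hα
    exact ⟨t1, t2, t4⟩
  have hTCF : ∀ α : ℝ, 9 / 5000 ≤ α → ∀ a a' : (geo9Y (f i)).Site,
      Real.exp (-(α * δF * (geo9Y (f i)).dist a a')) * wcY (f i).toKIdx a' ≤ (fun _ : ℝ => ΛC0) α * wcY (f i).toKIdx a := by
    intro α hα a a'
    have hκlo : 0 < 9 / 5000 * δF := by positivity
    have hκ : 9 / 5000 * δF ≤ α * δF := mul_le_mul_of_nonneg_right hα hδF0.le
    exact transfer_wcY (f i) (ιB i) (hι i) hκlo hκ hMCle a a'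
  -- the structured ℓ² readings of Q′, Q′*, F′, F′* (§1) at the base and at the product
  obtain ⟨hQc, hQc₁, hQcs, hQcs₁, hFc2, hFcs2⟩ := l2ReadingsQ_pair G (f i) (par i) b (ιB i) (Rr := F.Rr i) (Hp := F.Hp i) (hι i) hG1
    (hpar i) (hsym i) hM₂ hrepr hCq hVval hα₁.le hα1 (hC37 i α₁ V aa hC1).2
  have eQc : QcC (f i).toKIdx (par i) b (.base V) = F.Qc i U := rfl
  have eQc1 : QcC (f i).toKIdx (par i) b (.prod V aa) = F.Qc i ((codingYx G (f i) (C37 i) (C38 i)).bg.mul U' U) := rfl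
  have eQcs : QcsC (f i).toKIdx (par i) b (.base V) = F.Qcs i U := rfl
  have eQcs1 : QcsC (f i).toKIdx (par i) b (.prod V aa) = F.Qcs i ((codingYx G (f i) (C37 i) (C38 i)).bg.mul U' U) := rfl
  rw [eQc] at hQc
  rw [eQc1] at hQc₁
  rw [eQcs] at hQcs
  rw [eQcs1] at hQcs₁
  rw [eQc1, eQc] at hFc2
  rw [eQcs1, eQcs] at hFcs2
  -- ★ the four (3.68) entries of F(A), C⁻¹ on the block carrier
  have h68 := ineq368_l2_FP (R := F.Rr i) (H := F.Hp i) b (F.T i) (F.coord i U) (F.blk i) (F.blkP i) (F.d261 δF) ((((geo9Y (f i)).eta : ℂ))⁻¹) δF BG ΘV ΘW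
    κc κc θc θc BC BC' α₁ (F.Λf δF) (fun _ => ΛC0) (wcY (f i).toKIdx) (wsY (f i).toKIdx) hδF0 hBG0 hΘV0 hΘW0 hκc0 hκc0 hθc0 hθc0
    hBC0 hBC'0 hα₁.le (fun α hα => F.Λf_one_le δF α hδF0 hα) (fun α => hΛC00) (wcY_nonneg (f i).toKIdx) (wsY_nonneg (f i).toKIdx)
    (fun a => (wsY_mul_wcY (f i).toKIdx a).le) (F.dist_nonneg i) (F.dist_comm i) (F.triangle i) (F.len_pos i) h261F hSTF hTCF h365 h365'
    g0m g1m hGt0 hGt1 hGt2 hVG hGV hQc hQc₁ hQcs hQcs₁ hFc2 hFcs2 h348F h348F' (F.reg_cinv i α₀ U hM hα₀ hMa hU) hT1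
  obtain ⟨hPp, hDPp, hPpDs, hDPpDs⟩ := h68
  -- ★ the three (3.49) entries of R₀(U) from the readings
  obtain ⟨f1, f2, -, -, f4, -⟩ := F.hST_of i hδF0 hδFc hMF (1 / 100) (by norm_num)
  have hr49 : 21 / 25 * δF + (2 * (1 / 100) + 1 / 100) * δF ≤ (1 - 1 / 100) * δF := by nlinarith only [hδF0]
  have hδC : (1 - 1 / 100) * δF ≤ (1 - 1 / 100) * δF := le_rfl
  have lowF := fun (A : ℝ) (w : (geo9Y (f i)).Site → ℝ) (hA : 0 ≤ A) (hw : ∀ a, 0 ≤ w a) {T₀ : Module.End ℝ (SiteY (f i).toKIdx × ι → ℝ)}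
      (hT : HasL2Majorant (g := toB6 (geo9Y (f i)) (F.Rr i) (F.Hp i)) (fun p : SiteY (f i).toKIdx × ι => F.blk i p.1) T₀
        (fun a a' => A * w a * Real.exp (-(δF * (geo9Y (f i)).dist a a')))) =>
    low A w hA hw (show (1 - 1 / 100) * δF ≤ δF by nlinarith only [hδF0]) hT
  have h49 := ineq349_l2Hom_of_readingsP (R := F.Rr i) (H := F.Hp i) b (F.T i) (F.coord i U) (F.blk i) (F.blkP i) (F.d261 δF)
    ((((geo9Y (f i)).eta : ℂ))⁻¹) δF ((1 - 1 / 100) * δF) (1 / 100) (1 / 100) (21 / 25 * δF) ΛF BG δF (1 / 100) ΛC0 κc κc BC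
    (wcY (f i).toKIdx) (wsY (f i).toKIdx)
    hBG0 hΛF1 (by positivity) (by norm_num) (by norm_num) hδF0.le hr49 hκc0 hκc0 hBC0 hΛC00 (wsY_nonneg (f i).toKIdx)
    (fun a => (wsY_mul_wcY (f i).toKIdx a).le) hδC
    (F.dist_nonneg i) (F.triangle i) (F.len_pos i) (h261F (1 / 100) (by norm_num) (by norm_num)) f1 f2 f4 (hTCF (1 / 100) (by norm_num))
    (lowF BG _ hBG0 hw2 g0m) (fun μ => lowF BG _ hBG0 hw1 (g1m μ)) (fun ν => lowF BG _ hBG0 hw1 (g2m ν)) hQc hQcs h348F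
  obtain ⟨hP, hDP, hPDs⟩ := h49
  -- ★ (3.77) for the concrete P₁(A)
  obtain ⟨-, -, f1i, -, -, -⟩ := F.hST_of i hδF0 hδFc hMF (1 / 100) (by norm_num)
  have hr77 : 4 / 5 * δF + 2 * ((1 / 100 + 1 / 100) * δF) ≤ 21 / 25 * δF := by nlinarith only [hδF0]
  have h77 := ineq377_l2_concreteE (Rr := F.Rr i) (H := F.Hp i) b (F.T i) (F.coord i U) (F.blk i) (F.d261 δF) δF (21 / 25 * δF) (1 / 100) (1 / 100)
    (4 / 5 * δF) ΛF KP KPp α₁ F.d₀ F.M₂ hKP0 hKPp0 hα₁.le hΛF1 (by positivity) (by norm_num) (by norm_num) hδF0.le (by positivity) F.M₂_nonneg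
    hr77 (F.dist_nonneg i) (F.triangle i) (F.len_pos i) (h261F (1 / 100) (by norm_num) (by norm_num)) f1i F.hrepr (F.eta_pos i) (F.unitary i U)
    (F.expA i U U') hA (fun ν x => hAτ ν ν x) hsmall4 (F.stencilF i) (F.stencilB i) hP hDP hPDs hPp hDPp hPpDs hDPpDs
  -- the word IS `pOneConc` at the frame's letters; the constant at α₁ ≦ 1
  refine hasL2Majorant_mono (g := toB6 (geo9Y (f i)) (F.Rr i) (F.Hp i)) _ h77 fun a a' => ?_
  have hk : kappa377 cE KP KPp ΛF cFL α₁ ≤ kappa377 cE KP KPp ΛF cFL 1 :=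
    kappa377_le_one hcE0 hKP0 hKPp0 (zero_le_one.trans hΛF1) hcFL0 hα₁.le hα1
  have h0 : 0 ≤ α₁ * ((geo9Y (f i)).len a ^ 2)⁻¹ * Real.exp (-(4 / 5 * δF * (geo9Y (f i)).dist a a')) := by
    have := inv_nonneg.mpr (hw2 a); positivity
  calc _ = kappa377 cE KP KPp ΛF cFL α₁ * (α₁ * ((geo9Y (f i)).len a ^ 2)⁻¹ * Real.exp (-(4 / 5 * δF * (geo9Y (f i)).dist a a'))) := by
        rw [hcE, hΛF, hcFL]; ring
    _ ≤ κ₇ * (α₁ * ((geo9Y (f i)).len a ^ 2)⁻¹ * Real.exp (-(4 / 5 * δF * (geo9Y (f i)).dist a a'))) := mul_le_mul_of_nonneg_right hk h0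
    _ = _ := by ring

end Main

end Literature.MathematicalPhysics.QuantumFieldTheory.Balaban1983to89.B9SectBL2GRead377Y

end
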